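import Summits.SmoothPoincare4.SmoothPoincare4.Theses.CylinderEntropy
import Literature.MeasureTheory.Hausdorff.SphereHausdorffFinite
import Literature.MeasureTheory.Hausdorff.SphereAreaGeneral
import Literature.Topology.FourManifolds.HomotopyS4CompactProofs
import Literature.Geometry.Manifold.CylinderSlice
import Literature.Topology.FourManifolds.CerfGammaFourProofs

/-!
# Disproof of `CylinderRungTwo` — findings

Crux `stmt-SmoothPoincare4-7631` = `CylinderEntropy.CylinderRungTwo` (rank 2, "R"):
a homotopy 4-sphere `M` smoothly embedded in the round cylinder `N = S⁴×ℝ ⊂ ℝ⁶`,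
separating the two ends, with typed cylinder entropy `λ_cyl < 4/e`, is diffeomorphic to `S⁴`.

Standing-adversary file (refuter, cdisprove mode).  Prose lives in docstrings only.
Everything below is sorry-free EXCEPT the one documented near-miss `rungWithoutHomotopy_false`.

## Landed / published (cycle 1)

* LANDED p84777 (ACCEPTED, commit c1fc9bc3c9b8):
  `Summits/SmoothPoincare4/SmoothPoincare4/Theorems/CylinderRungTwo/Negative/CdisproveSandwichRungs.lean`
  (namespace `…Cruxes.CylinderRungTwo.Negative`, tree vocabulary, importable by every seat):
  `cylinderRungTwo_iff_tree` (the items' `⨆` IS `Literature.Geometry.Riemannian.SphericalCylinderEntropy.cylEntropy`,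
  `Iff.rfl`), `not_spc4_of_not_cylinderRungTwo`, `exotic_of_not_cylinderRungTwo` / `not_cylinderRungTwo_of_exotic`,
  `cylinderRungTwo_iff_forall_lt`, `not_cylEntropy_lt_one`, `weakenedCrux_twoSlices_false`,
  `two_le_cylEntropy_twoSlices`, `not_cylEntropy_twoSlices_lt`, `exists_thinCrossSection_of_diffeomorph`,
  `target_iff_spc4_of_sliceCalibration`.  (This work file keeps its own self-contained copies below; its
  `cylEntropy` is definitionally the tree's.)
* PUBLISHED: this file at `Cruxes/CylinderRungTwo/Disproof.lean` (crux tree).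
* The analytic lemmas of the ANALYTIC PART below were obtained independently and simultaneously by the sibling
  disprover of `SliceIsolation` and landed by it as `Literature/Geometry/Riemannian/SphericalCylinderEntropy.lean`
  (`measure_ratio_le_cylEntropy`, `one_le_cylEntropy_slice`, `hausdorffMeasure_sphere_le_of_separatesEnds`,
  `one_le_cylEntropy_of_separatesEnds`); `AreaFloor` is settled in the tree (`Theorems/CylinderEntropyAreaFloor.lean`).
  Prefer the tree names in new work.

## Findings (cycle 1)

* **SANDWICH (why it resists).** `SmoothPoincare4 → CylinderRungTwo` (`cylinderRungTwo_of_spc4`: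
  the conclusion of the crux is literally the summit's conclusion for the same `M`), hence
  `¬ CylinderRungTwo → ¬ SPC4`; any refutation is an exotic 4-sphere *together with* a thin
  cross-section (`exotic_of_not_rung`).  No junk escape (read-back in NOTES: `≃ₘ` is `C^∞` not
  `C^ω`; the immersion API is the classical normal form; `μH[4]` normalisations cancel; the typed
  Gegenbauer sum IS `C_k^{(3/2)}` — exact rational check `k ≤ 40`, kit job j005219 part A).
  Every hypothesis on `ι` only weakens the claim relative to SPC4 (`rung_of_spc4`,
  `rungWithout{Separation,Entropy,Embedding}_of_spc4`): none is load-bearing for TRUTH.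
* **The one load-bearing hypothesis is `M ≃ₕ S⁴`.**  Witness for dropping it: slice `S⁴×{0}` ⊔ a
  geodesic 4-sphere of radius `r` about `(e₀, 3)`; numerically (local preview, kit j005219 part D
  authoritative) `sup F̂ = 1.4433 (r=.02), 1.4434 (.05), 1.4459 (.2), 1.4492 (.3), 1.4595 (.5)`,
  all `< 4/e = 1.4715`, attained on-axis at `τ ≈ 0.123 r²` (Euclidean value `λ(S⁴)=32/(3e²)=1.44358`
  at `τ = r²/8`).  Topological halves proved (`separatesEnds_of_slice_subset`,
  `sum_sphere_not_diffeomorphic`, `rungWithoutHomotopy_false_of_witness`); the entropy half is the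
  near-miss `sorry` (needs `IsSmoothEmbedding` of an explicit map + a `μH[4]`-lintegral estimate).
* **TIGHTNESS AT THE BOTTOM (proved).** `measure_le_cylEntropy`: for measurable `A ⊆ N` of
  bounded height, `μH[4](A)/μH[4](S⁴) ≤ λ_cyl(A)` (large-scale limit at centre `e₀`: uniform tail
  bound `|𝔥(τ,s) - 1| ≤ e^{-4τ}·D` from the crude domination `|C_k| ≤ (k+2)! 2^k`, ratio test);
  `areaFloor : AreaFloor` (support item 7635 PROVED here — 1-Lipschitz projection + vertical
  segment; attached to 7635 as candidate proof); with the tree's `μH[4](S⁴) ∈ (0,∞)` and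
  `compactSpace_of_homotopyEquiv_sphere_four_holds`: **every cross-section of the crux's shape has
  `λ_cyl ≥ 1`** (`one_le_cylEntropy_of_homotopySphere`), so `Rung c` is VACUOUS for `c ≤ 1`
  (`rung_of_le_one`) and no `M ≃ₕ S⁴` has a cross-section below `1`
  (`not_hasCrossSectionBelow_of_le_one`): the free interval `[1, 4/e)` cannot be entered from
  below, `SliceIsolation` needs its `ε > 0`.  Thin cross-sections have small area
  (`measure_lt_of_thin`).  The slice itself has `λ_cyl ≥ 1` (`one_le_cylEntropy_slice`, via the
  isometry `q ↦ (q,0)`: `μH[4](slice) = μH[4](S⁴)`) — the lower half of `SliceCalibration`; its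
  upper half `≤ 1` (Funk–Hecke) is the calculus that stays open.
* **JOINT load-bearing (proved, using the tree's `Literature.Geometry.Manifold.CylinderSlice` by the
  sibling disprover of `SliceIsolation`):** dropping `M ≃ₕ S⁴` AND the entropy bound is false —
  `rungWithoutHomotopyEntropy_false` (`M = S⁴ ⊔ S⁴`, `ι = twoSlices`); and the entropy bound is
  exactly what excludes that witness: `two_le_cylEntropy_twoSlices` (`λ_cyl(two slices) ≥ 2`, from
  entropy ≥ area and `μH[4](slice c) = μH[4](S⁴)` for every `c`) with `4/e < 2`
  (`not_cylEntropy_twoSlices_lt`).  Hence a refutation of `RungWithoutHomotopy (4/e)` must use a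
  small-scale witness (small sphere / thin handle), whose entropy estimate is the near-miss.
* **Threshold bookkeeping.** `Rung c` antitone, `CylinderRungTwo = Rung (4/e)`,
  `SliceIsolation = ∃ ε>0, Rung (1+ε)`, `Rung c ↔ ∀ c' < c, RungLE c'` (strict `4/e` = all
  CMS-shape `≤ c'` below; the endpoint `≤ 4/e` is not claimed), crux ⇒ `SliceIsolation`
  (`ε = 4/e − 1 > 0`).  Every `Rung c` follows from SPC4: no threshold variant is refutable short
  of `¬SPC4`.
* **THE ROUTE IS EXACTLY AS HARD AS SPC4, modulo calibration (proved).**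
  `target_iff_spc4_of_sliceCalibration : SliceCalibration → (Target ↔ SmoothPoincare4)`:
  `E ⇐ SPC4` is `thinCrossSectionExists_of_spc4` (transport the slice along `M ≃ₘ S⁴` with the
  tree's `IsSmoothEmbedding.comp_diffeomorph` and `CylinderSlice.isSmoothEmbedding_sliceMap`),
  `R ⇐ SPC4` is the sandwich, `SPC4 ⇐ E ∧ R` is `closes`.  Non-vacuity of the crux modulo
  calibration: `hasCrossSectionBelow_sphere_of_sliceCalibration`.  And `not_rung_iff_exotic`:
  `¬ Rung c ↔ ∃` exotic sphere with a cross-section below `c`.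
* **Cheapest falsifier of the line (Hamilton's Harnack matrix for the product kernel on `S⁴×ℝ`)
  does not fire**: `S⁴` block = Hamilton's compact Einstein case (sec = 1 ≥ 0, ∇Ric = 0), the `ℝ`
  block of `Hess log k + g/2τ` vanishes for the Gaussian, no cross terms; small-time check of the
  typed kernel `𝔥(τ,1)(4πτ)²/vol → 1 + 2τ` (= `1 + Rτ/6`, `R_{S⁴} = 12`) and normalisation
  `(3/4)∫𝔥(τ,s)(1-s²)ds = 1.0000000` at `τ ∈ {3e-3, 3e-2, .3, 3}` (local preview; job j005219
  parts B/C authoritative; the job was still queued after 6.5 h when cycle 1 closed — its summary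
  auto-attaches to the item).
* **Literature (negative-results sweep, cycle 1; searchd degraded most of the session, zbMATH /
  Crossref / galaxy at the end).**  No printed counterexample or obstruction touches R.  The typed
  functional IS the printed intrinsic entropy of Ao Sun, *Entropy in a closed manifold and partial
  regularity of MCF limit of surfaces*, JGA 2020 = arXiv:1912.09431, Def. 1.1
  (`λ(M) = sup_{x∈𝒩, t>0} t^{(n-m)/2} ∫_M ℋ_𝒩(x,y,t) dy`; here `λ_cyl = (4π)^{1/2}·λ_Sun` on
  `𝒩 = S⁴×ℝ`), and his Thm 1.5 (read, p.4) is exactly the route's engine: monotone non-increasing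
  along MCF when `𝒩` has `sec ≥ 0` and parallel Ricci, by Hamilton's matrix Harnack — stated for
  closed `𝒩`, the same computation on the complete `S⁴×ℝ`; so kill-criterion (iii) of the route
  (Harnack matrix not `≥ 0`) cannot fire.  Hershkovits–White, Geom. Topol. 2019 = arXiv:1803.00637,
  Thms 1–2 (read, pp.3–4): closed SHRINKERS with nontrivial `k`-th homology / complement homotopy
  have `λ ≥ λ(S^k)`; in the cylinder the analogue fails by design (the slice's complement has
  `π₄ ≠ 0` yet `λ_cyl = 1`), which is why the free interval here is `[1, 4/e)` and not CIMW's
  `[λ(S⁴), 4/e)`.  Mechanism-relevant prior art for provers: Chodosh–Choi–Mantoulidis–Schulze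
  (Duke 2024) / Chodosh–Mantoulidis–Schulze II (Duke 2025), Mramor–S. Wang *Low entropy and MCF with
  surgery* (CVPDE 2021), Ao Sun *Local entropy and generic multiplicity-one singularities* (JDG 2023,
  curved ambient 3-manifolds), C. Bao (Sci. China Math. 2015, `λ < 2 ⇒` multiplicity-one tangent
  flows).
-/

set_option linter.dupNamespace false

namespace Summit.SmoothPoincare4.SmoothPoincare4.Cruxes.CylinderRungTwo.Disproof

open scoped BigOperators Topology Manifold ContDiff ENNReal MeasureTheory ContinuousMap NNReal
open MeasureTheory Set Filter
open Summit.SmoothPoincare4.SmoothPoincare4.Theses.CylinderEntropy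

noncomputable section

/-- Local notation: the ambient `ℝ⁶`. -/
local notation "E⁶" => EuclideanSpace ℝ (Fin 6)
/-- Local notation: the standard `S⁴ ⊂ ℝ⁵` with Mathlib's manifold structure. -/
local notation "𝕊⁴" => (Metric.sphere (0 : EuclideanSpace ℝ (Fin 5)) 1)

/-! ## The typed objects, named -/

/-- The typed cylinder entropy `λ_cyl(A)` of a subset `A ⊆ ℝ⁶`: verbatim the `⨆` of the items
(sup over centres `p ∈ N` and scales `τ > 0` of the slice-normalised kernel area). -/
def cylEntropy (A : Set E⁶) : ℝ≥0∞ :=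
  ⨆ (p : EuclideanSpace ℝ (Fin 6)) (_ : ∑ i : Fin 5, p (Fin.castSucc i) ^ 2 = 1) (τ : ℝ)
    (_ : 0 < τ), (μH[4] (Metric.sphere (0 : EuclideanSpace ℝ (Fin 5)) 1))⁻¹ *
      ∫⁻ z in A, ENNReal.ofReal ((∑' k : ℕ, Real.exp (-((k : ℝ) * ((k : ℝ) + 3)) * τ) *
        ((2 * (k : ℝ) + 3) / 3) * ∑ l ∈ Finset.range (k / 2 + 1), (-1 : ℝ) ^ l *
        (∏ j ∈ Finset.range (k - l), ((3 : ℝ) / 2 + (j : ℝ))) /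
        (((l.factorial : ℕ) : ℝ) * (((k - 2 * l).factorial : ℕ) : ℝ)) *
        (2 * ∑ i : Fin 5, z (Fin.castSucc i) * p (Fin.castSucc i)) ^ (k - 2 * l)) *
        Real.exp (-((z 5 - p 5) ^ 2) / (4 * τ))) ∂μH[4]

/-- The image lies in the cylinder `N = {∑_{i<5} z_i² = 1}`. -/
def InCylinder {M : Type*} (ι : M → E⁶) : Prop :=
  ∀ x, ∑ i : Fin 5, ι x (Fin.castSucc i) ^ 2 = 1

/-- The typed separation predicate: for some `R`, no path in `N ∖ A` joins height `≤ -R` to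
height `≥ R`. -/
def SeparatesEnds (A : Set E⁶) : Prop :=
  ∃ R : ℝ, ∀ a b : EuclideanSpace ℝ (Fin 6), ∑ i : Fin 5, a (Fin.castSucc i) ^ 2 = 1 →
    ∑ i : Fin 5, b (Fin.castSucc i) ^ 2 = 1 → a 5 ≤ -R → R ≤ b 5 →
    ¬ JoinedIn ({z : EuclideanSpace ℝ (Fin 6) | ∑ i : Fin 5, z (Fin.castSucc i) ^ 2 = 1} \ A) a b

/-- `M` admits a cross-section embedding of cylinder entropy `< c`. -/
def HasCrossSectionBelow (M : Type) [TopologicalSpace M]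
    [ChartedSpace (EuclideanSpace ℝ (Fin 4)) M] (c : ℝ≥0∞) : Prop :=
  ∃ ι : M → E⁶, Manifold.IsSmoothEmbedding (𝓡 4) (𝓡 6) ∞ ι ∧ InCylinder ι ∧
    SeparatesEnds (Set.range ι) ∧ cylEntropy (Set.range ι) < c

/-- The rung predicate at threshold `c`: the crux with `4/e` replaced by `c`. -/
def Rung (c : ℝ≥0∞) : Prop :=
  ∀ (M : Type) [TopologicalSpace M] [T2Space M] [SecondCountableTopology M]
    [ChartedSpace (EuclideanSpace ℝ (Fin 4)) M] [IsManifold (𝓡 4) ∞ M],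
    M ≃ₕ 𝕊⁴ → ∀ ι : M → E⁶, Manifold.IsSmoothEmbedding (𝓡 4) (𝓡 6) ∞ ι → InCylinder ι →
    SeparatesEnds (Set.range ι) → cylEntropy (Set.range ι) < c →
    Nonempty (M ≃ₘ⟮𝓡 4, 𝓡 4⟯ 𝕊⁴)

/-- The non-strict variant (`≤ c`, the shape of Chodosh–Mantoulidis–Schulze Cor 1.5(b)). -/
def RungLE (c : ℝ≥0∞) : Prop :=
  ∀ (M : Type) [TopologicalSpace M] [T2Space M] [SecondCountableTopology M]
    [ChartedSpace (EuclideanSpace ℝ (Fin 4)) M] [IsManifold (𝓡 4) ∞ M],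
    M ≃ₕ 𝕊⁴ → ∀ ι : M → E⁶, Manifold.IsSmoothEmbedding (𝓡 4) (𝓡 6) ∞ ι → InCylinder ι →
    SeparatesEnds (Set.range ι) → cylEntropy (Set.range ι) ≤ c →
    Nonempty (M ≃ₘ⟮𝓡 4, 𝓡 4⟯ 𝕊⁴)

/-! ## The items are instances of `Rung` -/

theorem cylinderRungTwo_iff_rung :
    CylinderRungTwo ↔ Rung (ENNReal.ofReal (4 / Real.exp 1)) := Iff.rfl

theorem sliceIsolation_iff_rung :
    SliceIsolation ↔ ∃ ε : ℝ, 0 < ε ∧ Rung (ENNReal.ofReal (1 + ε)) := Iff.rfl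

theorem thinCrossSectionExists_iff :
    ThinCrossSectionExists ↔
      ∀ (M : Type) [TopologicalSpace M] [T2Space M] [SecondCountableTopology M]
        [ChartedSpace (EuclideanSpace ℝ (Fin 4)) M] [IsManifold (𝓡 4) ∞ M],
        M ≃ₕ 𝕊⁴ → HasCrossSectionBelow M (ENNReal.ofReal (4 / Real.exp 1)) := Iff.rfl

/-- The target of the route is literally `E ∧ R`. -/
theorem target_iff : Target ↔ ThinCrossSectionExists ∧ CylinderRungTwo := Iff.rfl

/-! ## Sandwich: the crux sits between SPC4 and SPC4-for-thin-spheres -/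

/-- Dropping EVERY hypothesis about `ι` gives exactly the summit statement. -/
theorem bareRecognition_iff_spc4 :
    (∀ (M : Type) [TopologicalSpace M] [T2Space M] [SecondCountableTopology M]
      [ChartedSpace (EuclideanSpace ℝ (Fin 4)) M] [IsManifold (𝓡 4) ∞ M],
      M ≃ₕ 𝕊⁴ → Nonempty (M ≃ₘ⟮𝓡 4, 𝓡 4⟯ 𝕊⁴)) ↔ _root_.SmoothPoincare4 := Iff.rfl

/-- SPC4 implies every rung: no hypothesis on `ι` is load-bearing for truth. -/
theorem rung_of_spc4 (h : _root_.SmoothPoincare4) (c : ℝ≥0∞) : Rung c := by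
  intro M _ _ _ _ _ e ι _ _ _ _
  exact h M ‹_› ‹_› e

theorem rungLE_of_spc4 (h : _root_.SmoothPoincare4) (c : ℝ≥0∞) : RungLE c := by
  intro M _ _ _ _ _ e ι _ _ _ _
  exact h M ‹_› ‹_› e

/-- **Why the crux resists refutation**: it is a consequence of the summit. -/
theorem cylinderRungTwo_of_spc4 (h : _root_.SmoothPoincare4) : CylinderRungTwo :=
  rung_of_spc4 h _

/-- Contrapositive: a refutation of the crux is a disproof of the smooth 4-dimensional Poincaré
conjecture (as typed in the tree). -/
theorem not_spc4_of_not_cylinderRungTwo (h : ¬ CylinderRungTwo) : ¬ _root_.SmoothPoincare4 :=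
  fun h' => h (cylinderRungTwo_of_spc4 h')

/-- The shape of ANY refutation of `Rung c`: an exotic 4-sphere carrying a cross-section of
cylinder entropy `< c`. -/
theorem exotic_of_not_rung {c : ℝ≥0∞} (h : ¬ Rung c) :
    ∃ (M : Type) (_ : TopologicalSpace M) (_ : T2Space M) (_ : SecondCountableTopology M)
      (_ : ChartedSpace (EuclideanSpace ℝ (Fin 4)) M) (_ : IsManifold (𝓡 4) ∞ M),
      Nonempty (M ≃ₕ 𝕊⁴) ∧ HasCrossSectionBelow M c ∧ IsEmpty (M ≃ₘ⟮𝓡 4, 𝓡 4⟯ 𝕊⁴) := by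
  by_contra h'
  apply h
  intro M _ _ _ _ _ e ι hι hN hsep hlt
  by_contra hne
  exact h' ⟨M, ‹_›, ‹_›, ‹_›, ‹_›, ‹_›, ⟨e⟩, ⟨ι, hι, hN, hsep, hlt⟩, ⟨fun d => hne ⟨d⟩⟩⟩

/-- Conversely an exotic sphere with a cross-section below `c` kills `Rung c`. -/
theorem not_rung_of_exotic {c : ℝ≥0∞}
    (h : ∃ (M : Type) (_ : TopologicalSpace M) (_ : T2Space M) (_ : SecondCountableTopology M)
      (_ : ChartedSpace (EuclideanSpace ℝ (Fin 4)) M) (_ : IsManifold (𝓡 4) ∞ M),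
      Nonempty (M ≃ₕ 𝕊⁴) ∧ HasCrossSectionBelow M c ∧ IsEmpty (M ≃ₘ⟮𝓡 4, 𝓡 4⟯ 𝕊⁴)) :
    ¬ Rung c := by
  obtain ⟨M, _, _, _, _, _, ⟨e⟩, ⟨ι, hι, hN, hsep, hlt⟩, hempty⟩ := h
  intro hR
  obtain ⟨d⟩ := hR M e ι hι hN hsep hlt
  exact hempty.false d

/-- `Rung c` together with existence of cross-sections below `c` gives the summit
(generalises the route's deciding theorem `closes`). -/
theorem spc4_of_rung_of_thin {c : ℝ≥0∞} (hR : Rung c)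
    (hE : ∀ (M : Type) [TopologicalSpace M] [T2Space M] [SecondCountableTopology M]
      [ChartedSpace (EuclideanSpace ℝ (Fin 4)) M] [IsManifold (𝓡 4) ∞ M],
      M ≃ₕ 𝕊⁴ → HasCrossSectionBelow M c) : _root_.SmoothPoincare4 := by
  intro M _ _ _ cs im e
  obtain ⟨ι, hι, hN, hsep, hlt⟩ := hE M e
  exact hR M e ι hι hN hsep hlt

/-- Given the existence half `E`, the crux is EQUIVALENT to the summit. -/
theorem cylinderRungTwo_iff_spc4_of_thin (hE : ThinCrossSectionExists) :
    CylinderRungTwo ↔ _root_.SmoothPoincare4 :=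
  ⟨fun hR => spc4_of_rung_of_thin (c := ENNReal.ofReal (4 / Real.exp 1)) hR hE,
    cylinderRungTwo_of_spc4⟩

/-! ## Threshold bookkeeping (tightness of the statement, not of the mechanism) -/

/-- Rungs are antitone in the threshold. -/
theorem rung_anti {c c' : ℝ≥0∞} (hle : c ≤ c') (h : Rung c') : Rung c := by
  intro M _ _ _ _ _ e ι hι hN hsep hlt
  exact h M e ι hι hN hsep (lt_of_lt_of_le hlt hle)

theorem rungLE_anti {c c' : ℝ≥0∞} (hle : c ≤ c') (h : RungLE c') : RungLE c := by
  intro M _ _ _ _ _ e ι hι hN hsep hle'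
  exact h M e ι hι hN hsep (hle'.trans hle)

theorem rung_of_rungLE {c : ℝ≥0∞} (h : RungLE c) : Rung c := by
  intro M _ _ _ _ _ e ι hι hN hsep hlt
  exact h M e ι hι hN hsep hlt.le

theorem rungLE_of_rung {c c' : ℝ≥0∞} (hlt : c < c') (h : Rung c') : RungLE c := by
  intro M _ _ _ _ _ e ι hι hN hsep hle
  exact h M e ι hι hN hsep (lt_of_le_of_lt hle hlt)

/-- Because the entropy hypothesis is strict, a rung is the conjunction of all rungs strictly
below it … -/
theorem rung_iff_forall_lt (c : ℝ≥0∞) : Rung c ↔ ∀ c' < c, Rung c' := by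
  refine ⟨fun h c' hc' => rung_anti hc'.le h, fun h => ?_⟩
  intro M _ _ _ _ _ e ι hι hN hsep hlt
  obtain ⟨c', h1, h2⟩ := exists_between hlt
  exact h c' h2 M e ι hι hN hsep h1

/-- … equivalently of all NON-STRICT rungs strictly below it: `CylinderRungTwo` is exactly
"CMS Cor 1.5(b)-shape with `≤ c'` for every `c' < 4/e`"; the endpoint `≤ 4/e` is not claimed. -/
theorem rung_iff_forall_lt_rungLE (c : ℝ≥0∞) : Rung c ↔ ∀ c' < c, RungLE c' := by
  refine ⟨fun h c' hc' => rungLE_of_rung hc' h, fun h => ?_⟩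
  intro M _ _ _ _ _ e ι hι hN hsep hlt
  obtain ⟨c', h1, h2⟩ := exists_between hlt
  exact h c' h2 M e ι hι hN hsep h1.le

/-- The bottom rung is vacuous. -/
theorem rung_zero : Rung 0 := by
  intro M _ _ _ _ _ e ι hι hN hsep hlt
  exact absurd hlt ENNReal.not_lt_zero

/-- `4/e - 1 > 0`, i.e. `e < 4` (the width of the free interval is positive). -/
theorem four_div_exp_one_sub_one_pos : 0 < 4 / Real.exp 1 - 1 := by
  have h := Real.exp_one_lt_d9
  have hpos := Real.exp_pos 1
  rw [sub_pos, lt_div_iff₀ hpos]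
  linarith

/-- The crux implies `SliceIsolation` with `ε = 4/e - 1` (so `SliceIsolation` adds no
fragility to the line; also proved in the planner's sketch). -/
theorem sliceIsolation_of_cylinderRungTwo (h : CylinderRungTwo) : SliceIsolation := by
  rw [sliceIsolation_iff_rung]
  refine ⟨4 / Real.exp 1 - 1, four_div_exp_one_sub_one_pos, ?_⟩
  have : (1 : ℝ) + (4 / Real.exp 1 - 1) = 4 / Real.exp 1 := by ring
  rw [this]
  exact h

/-- More generally any rung above `1` gives `SliceIsolation`. -/
theorem sliceIsolation_of_rung {c : ℝ} (hc : 1 < c) (h : Rung (ENNReal.ofReal c)) :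
    SliceIsolation := by
  rw [sliceIsolation_iff_rung]
  refine ⟨c - 1, sub_pos.mpr hc, ?_⟩
  have : (1 : ℝ) + (c - 1) = c := by ring
  rw [this]
  exact h

/-! ## Load-bearing analysis: the homotopy hypothesis -/

/-- The crux with the hypothesis `M ≃ₕ S⁴` DROPPED (everything else verbatim). -/
def RungWithoutHomotopy (c : ℝ≥0∞) : Prop :=
  ∀ (M : Type) [TopologicalSpace M] [T2Space M] [SecondCountableTopology M]
    [ChartedSpace (EuclideanSpace ℝ (Fin 4)) M] [IsManifold (𝓡 4) ∞ M],
    ∀ ι : M → E⁶, Manifold.IsSmoothEmbedding (𝓡 4) (𝓡 6) ∞ ι → InCylinder ι →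
    SeparatesEnds (Set.range ι) → cylEntropy (Set.range ι) < c →
    Nonempty (M ≃ₘ⟮𝓡 4, 𝓡 4⟯ 𝕊⁴)

theorem rung_of_rungWithoutHomotopy {c : ℝ≥0∞} (h : RungWithoutHomotopy c) : Rung c := by
  intro M _ _ _ _ _ _ ι hι hN hsep hlt
  exact h M ι hι hN hsep hlt

/-- The slice at height `h`: `S⁴ × {h} ⊂ N`. -/
def slice (h : ℝ) : Set E⁶ :=
  {z : E⁶ | ∑ i : Fin 5, z (Fin.castSucc i) ^ 2 = 1 ∧ z 5 = h}

/-- **Separation is cheap**: any subset of `ℝ⁶` containing a whole slice separates the ends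
(intermediate value theorem on the height along a joining path).  In particular the separation
hypothesis holds for the slice, for the slice ⊔ anything, and for the two load-bearing
witnesses below. -/
theorem separatesEnds_of_slice_subset {A : Set E⁶} {h : ℝ} (hA : slice h ⊆ A) :
    SeparatesEnds A := by
  refine ⟨|h| + 1, fun a b ha hb ha5 hb5 hJ => ?_⟩
  -- a path in `N \ A` from `a` to `b`
  let γ := hJ.somePath
  have hγ : ∀ t, γ t ∈ ({z : E⁶ | ∑ i : Fin 5, z (Fin.castSucc i) ^ 2 = 1} \ A) :=
    fun t => hJ.somePath_mem t
  -- the height along the extended path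
  let g : ℝ → ℝ := fun t => (γ.extend t) 5
  have hg : Continuous g := by
    have h1 : Continuous fun t : ℝ => γ.extend t := γ.continuous_extend
    exact (EuclideanSpace.proj (5 : Fin 6)).continuous.comp h1
  have hg0 : g 0 = a 5 := by simp [g]
  have hg1 : g 1 = b 5 := by simp [g]
  have hle0 : g 0 ≤ h := by
    rw [hg0]; have := neg_abs_le h; linarith
  have hle1 : h ≤ g 1 := by
    rw [hg1]; have := le_abs_self h; linarith
  obtain ⟨t, ht, hgt⟩ :=
    intermediate_value_Icc (zero_le_one : (0 : ℝ) ≤ 1) hg.continuousOn ⟨hle0, hle1⟩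
  have hmem : γ.extend t ∈ ({z : E⁶ | ∑ i : Fin 5, z (Fin.castSucc i) ^ 2 = 1} \ A) := by
    rw [Path.extend_extends' γ ⟨t, ht⟩]
    exact hγ _
  refine hmem.2 (hA ⟨hmem.1, ?_⟩)
  exact hgt

/-- No disconnected `M` is diffeomorphic to `S⁴`. -/
theorem isEmpty_diffeomorph_sphere_of_not_preconnectedSpace (M : Type) [TopologicalSpace M]
    [ChartedSpace (EuclideanSpace ℝ (Fin 4)) M] (hM : ¬ PreconnectedSpace M) :
    IsEmpty (M ≃ₘ⟮𝓡 4, 𝓡 4⟯ 𝕊⁴) := by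
  refine ⟨fun d => hM ?_⟩
  have hrank : 1 < Module.rank ℝ (EuclideanSpace ℝ (Fin 5)) := by
    rw [← Module.finrank_eq_rank, finrank_euclideanSpace_fin]
    norm_num
  have hS : IsPreconnected (Metric.sphere (0 : EuclideanSpace ℝ (Fin 5)) 1) :=
    isPreconnected_sphere hrank 0 1
  haveI : PreconnectedSpace 𝕊⁴ := Subtype.preconnectedSpace hS
  have hS' : IsPreconnected (Set.univ : Set 𝕊⁴) := isPreconnected_univ
  have himg : IsPreconnected ((fun x => d.symm x) '' (Set.univ : Set 𝕊⁴)) :=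
    hS'.image _ d.symm.continuous.continuousOn
  have hsurj : (fun x => d.symm x) '' (Set.univ : Set 𝕊⁴) = Set.univ := by
    rw [Set.image_univ, Set.range_eq_univ]
    exact d.symm.surjective
  rw [hsurj] at himg
  exact ⟨himg⟩

/-- The abstract manifold of the load-bearing witness "slice ⊔ small far sphere" (and of
"two slices"): `S⁴ ⊔ S⁴` is not diffeomorphic to `S⁴`. -/
theorem sum_sphere_not_diffeomorphic : IsEmpty ((𝕊⁴ ⊕ 𝕊⁴) ≃ₘ⟮𝓡 4, 𝓡 4⟯ 𝕊⁴) := by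
  apply isEmpty_diffeomorph_sphere_of_not_preconnectedSpace
  intro hpc
  have hpt : (Metric.sphere (0 : EuclideanSpace ℝ (Fin 5)) 1).Nonempty :=
    (NormedSpace.sphere_nonempty).mpr zero_le_one
  obtain ⟨x, hx⟩ := hpt
  have hclopen : IsClopen (Set.range (Sum.inl : 𝕊⁴ → 𝕊⁴ ⊕ 𝕊⁴)) := isClopen_range_inl
  rcases isClopen_iff.mp hclopen with h0 | h1
  · exact (Set.range_nonempty_iff_nonempty.mpr ⟨⟨x, hx⟩⟩).ne_empty h0
  · have : (Sum.inr ⟨x, hx⟩ : 𝕊⁴ ⊕ 𝕊⁴) ∈ Set.range (Sum.inl : 𝕊⁴ → 𝕊⁴ ⊕ 𝕊⁴) := by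
      rw [h1]; exact Set.mem_univ _
    obtain ⟨y, hy⟩ := this
    exact Sum.inl_ne_inr hy

/-- **NEAR-MISS (documented `sorry`, work file only).**  `M ≃ₕ S⁴` is load-bearing:
`RungWithoutHomotopy (4/e)` is false.  Witness: `M = S⁴ ⊔ S⁴`, `ι` = (slice `S⁴×{0}`) ⊔ (a round
4-sphere of radius `r → 0` inside `N` at height `10`).  Hypotheses: embedding ✓ (both pieces are
classical embeddings, disjoint compact images); in `N` ✓; separation ✓
(`separatesEnds_of_slice_subset`); entropy: at centres near the small sphere and scales `τ ~ r²`
the functional is the Euclidean Gaussian area up to `O(r)`, `→ λ(S⁴ ⊂ ℝ⁵) = 1.4436`, the slice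
contributing `≤ e^{-100/4τ}`; at scales `τ ≳ r` the small sphere contributes `O(r⁴/τ²)` and the
slice `≤ 1`; so `λ_cyl → max(1, 1.4436) < 4/e = 1.4715` (margin `0.028`).  Conclusion ✗
(`sum_sphere_not_diffeomorphic`).  Connected upgrade: slice with one thin `S³×I` handle
(`≅ S¹×S³`, neck density `λ(S³×ℝ)=1.4531`, catenoidal junctions) — the `#k S¹×S³` alternative of
CMS Cor 1.5(b).  OBSTRUCTION to closing in Lean: (i) `Manifold.IsSmoothEmbedding` of an explicit
map needs immersion charts by hand (`IsSmoothEmbedding.comp` is only `proof_wanted` in Mathlib);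
(ii) the bound `cylEntropy (range ι) < 4/e` needs `μH[4]`-lintegrals of the Gegenbauer heat-kernel
series over spheres (Funk–Hecke, small-time kernel asymptotics) — none of it is in reach; even the
calibration `λ_cyl(slice) = 1` (`SliceCalibration`) is an open tree item. -/
theorem rungWithoutHomotopy_false :
    ¬ RungWithoutHomotopy (ENNReal.ofReal (4 / Real.exp 1)) := by
  sorry

/-- The near-miss made precise: the ONLY missing inputs are (i) a smooth-embedding certificate
for a map `S⁴ ⊔ S⁴ → N` whose image contains a slice and (ii) its entropy bound.  Given those,
`RungWithoutHomotopy c` fails (separation from `separatesEnds_of_slice_subset`, conclusion from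
`sum_sphere_not_diffeomorphic`). -/
theorem rungWithoutHomotopy_false_of_witness {c : ℝ≥0∞}
    (hw : ∃ ι : (𝕊⁴ ⊕ 𝕊⁴) → E⁶, Manifold.IsSmoothEmbedding (𝓡 4) (𝓡 6) ∞ ι ∧ InCylinder ι ∧
      (∃ h : ℝ, slice h ⊆ Set.range ι) ∧ cylEntropy (Set.range ι) < c) :
    ¬ RungWithoutHomotopy c := by
  obtain ⟨ι, hι, hN, ⟨h, hsl⟩, hlt⟩ := hw
  intro hR
  obtain ⟨d⟩ := hR (𝕊⁴ ⊕ 𝕊⁴) ι hι hN (separatesEnds_of_slice_subset hsl) hlt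
  exact sum_sphere_not_diffeomorphic.false d

/-! ## Load-bearing analysis: the hypotheses on `ι` are NOT load-bearing for truth -/

/-- The crux with the SEPARATION hypothesis dropped. -/
def RungWithoutSeparation (c : ℝ≥0∞) : Prop :=
  ∀ (M : Type) [TopologicalSpace M] [T2Space M] [SecondCountableTopology M]
    [ChartedSpace (EuclideanSpace ℝ (Fin 4)) M] [IsManifold (𝓡 4) ∞ M],
    M ≃ₕ 𝕊⁴ → ∀ ι : M → E⁶, Manifold.IsSmoothEmbedding (𝓡 4) (𝓡 6) ∞ ι → InCylinder ι →
    cylEntropy (Set.range ι) < c → Nonempty (M ≃ₘ⟮𝓡 4, 𝓡 4⟯ 𝕊⁴)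

/-- The crux with the ENTROPY hypothesis dropped. -/
def RungWithoutEntropy : Prop :=
  ∀ (M : Type) [TopologicalSpace M] [T2Space M] [SecondCountableTopology M]
    [ChartedSpace (EuclideanSpace ℝ (Fin 4)) M] [IsManifold (𝓡 4) ∞ M],
    M ≃ₕ 𝕊⁴ → ∀ ι : M → E⁶, Manifold.IsSmoothEmbedding (𝓡 4) (𝓡 6) ∞ ι → InCylinder ι →
    SeparatesEnds (Set.range ι) → Nonempty (M ≃ₘ⟮𝓡 4, 𝓡 4⟯ 𝕊⁴)

/-- The crux with the EMBEDDING and IN-CYLINDER hypotheses dropped. -/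
def RungWithoutEmbedding (c : ℝ≥0∞) : Prop :=
  ∀ (M : Type) [TopologicalSpace M] [T2Space M] [SecondCountableTopology M]
    [ChartedSpace (EuclideanSpace ℝ (Fin 4)) M] [IsManifold (𝓡 4) ∞ M],
    M ≃ₕ 𝕊⁴ → ∀ ι : M → E⁶, SeparatesEnds (Set.range ι) → cylEntropy (Set.range ι) < c →
    Nonempty (M ≃ₘ⟮𝓡 4, 𝓡 4⟯ 𝕊⁴)

theorem rungWithoutSeparation_of_spc4 (h : _root_.SmoothPoincare4) (c : ℝ≥0∞) :
    RungWithoutSeparation c := by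
  intro M _ _ _ _ _ e ι _ _ _
  exact h M ‹_› ‹_› e

theorem rungWithoutEntropy_of_spc4 (h : _root_.SmoothPoincare4) : RungWithoutEntropy := by
  intro M _ _ _ _ _ e ι _ _ _
  exact h M ‹_› ‹_› e

theorem rungWithoutEmbedding_of_spc4 (h : _root_.SmoothPoincare4) (c : ℝ≥0∞) :
    RungWithoutEmbedding c := by
  intro M _ _ _ _ _ e ι _ _
  exact h M ‹_› ‹_› e

/-- … and each of them still implies the crux, so each sits in the same SPC4-sandwich:
irrefutable short of an exotic sphere, unprovable short of SPC4-for-a-class. -/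
theorem rung_of_rungWithoutSeparation {c : ℝ≥0∞} (h : RungWithoutSeparation c) : Rung c := by
  intro M _ _ _ _ _ e ι hι hN _ hlt
  exact h M e ι hι hN hlt

theorem rung_of_rungWithoutEntropy (h : RungWithoutEntropy) (c : ℝ≥0∞) : Rung c := by
  intro M _ _ _ _ _ e ι hι hN hsep _
  exact h M e ι hι hN hsep

theorem rung_of_rungWithoutEmbedding {c : ℝ≥0∞} (h : RungWithoutEmbedding c) : Rung c := by
  intro M _ _ _ _ _ e ι _ _ hsep hlt
  exact h M e ι hsep hlt


/-! # ANALYTIC PART -/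

local notation "E⁵" => EuclideanSpace ℝ (Fin 5)

/-- Pochhammer-type product `∏_{j<k-l} (3/2 + j)` of the typed Gegenbauer coefficient. -/
def P (k l : ℕ) : ℝ := ∏ j ∈ Finset.range (k - l), ((3 : ℝ) / 2 + (j : ℝ))

/-- The typed Gegenbauer polynomial `C_k^{(3/2)}(s)` (explicit finite sum, verbatim). -/
def T (k : ℕ) (s : ℝ) : ℝ :=
  ∑ l ∈ Finset.range (k / 2 + 1), (-1 : ℝ) ^ l *
    (∏ j ∈ Finset.range (k - l), ((3 : ℝ) / 2 + (j : ℝ))) /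
    (((l.factorial : ℕ) : ℝ) * (((k - 2 * l).factorial : ℕ) : ℝ)) * (2 * s) ^ (k - 2 * l)

/-- The `k`-th term of the typed zonal heat-kernel series. -/
def a (k : ℕ) (τ s : ℝ) : ℝ :=
  Real.exp (-((k : ℝ) * ((k : ℝ) + 3)) * τ) * ((2 * (k : ℝ) + 3) / 3) * T k s

/-- The typed zonal heat kernel `vol(S⁴)·H_{S⁴}` as a `tsum`. -/
def S (τ s : ℝ) : ℝ := ∑' k : ℕ, a k τ s

/-- `cylEntropy` unfolds to the `S`-form (definitional). -/
theorem cylEntropy_eq (A : Set E⁶) : cylEntropy A =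
    ⨆ (p : EuclideanSpace ℝ (Fin 6)) (_ : ∑ i : Fin 5, p (Fin.castSucc i) ^ 2 = 1) (τ : ℝ)
    (_ : 0 < τ), (μH[4] (Metric.sphere (0 : EuclideanSpace ℝ (Fin 5)) 1))⁻¹ *
      ∫⁻ z in A, ENNReal.ofReal (S τ (∑ i : Fin 5, z (Fin.castSucc i) * p (Fin.castSucc i)) *
        Real.exp (-((z 5 - p 5) ^ 2) / (4 * τ))) ∂μH[4] := rfl

/-! ### read-back lemmas -/

theorem T_zero (s : ℝ) : T 0 s = 1 := by
  simp [T]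

theorem T_one (s : ℝ) : T 1 s = 3 * s := by
  simp [T]
  ring

theorem T_two (s : ℝ) : T 2 s = 15 / 2 * s ^ 2 - 3 / 2 := by
  simp [T, Finset.sum_range_succ, Finset.prod_range_succ]
  ring

theorem a_zero (τ s : ℝ) : a 0 τ s = 1 := by
  simp [a, T_zero]

/-! ### crude bounds -/

theorem P_nonneg (k l : ℕ) : 0 ≤ P k l := by
  unfold P
  exact Finset.prod_nonneg fun j _ => by positivity

/-- `∏_{j<m} (2 + j) = (m+1)!` -/
theorem prod_range_two_add (m : ℕ) :
    ∏ j ∈ Finset.range m, ((2 : ℝ) + (j : ℝ)) = ((m + 1).factorial : ℝ) := by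
  induction m with
  | zero => simp
  | succ n ih =>
    rw [Finset.prod_range_succ, ih, Nat.factorial_succ (n + 1)]
    push_cast
    ring

theorem P_le (k l : ℕ) : P k l ≤ ((k + 1).factorial : ℝ) := by
  unfold P
  calc ∏ j ∈ Finset.range (k - l), ((3 : ℝ) / 2 + (j : ℝ))
      ≤ ∏ j ∈ Finset.range (k - l), ((2 : ℝ) + (j : ℝ)) := by
        apply Finset.prod_le_prod
        · intro j _; positivity
        · intro j _; linarith
    _ = ((k - l + 1).factorial : ℝ) := prod_range_two_add (k - l)
    _ ≤ ((k + 1).factorial : ℝ) := by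
        exact_mod_cast Nat.factorial_le (by omega)

/-- `|T k s| ≤ (k+2)! 2^k` for `|s| ≤ 1`. -/
theorem abs_T_le (k : ℕ) {s : ℝ} (hs : |s| ≤ 1) :
    |T k s| ≤ ((k + 2).factorial : ℝ) * 2 ^ k := by
  unfold T
  have hterm : ∀ l ∈ Finset.range (k / 2 + 1),
      |(-1 : ℝ) ^ l * (∏ j ∈ Finset.range (k - l), ((3 : ℝ) / 2 + (j : ℝ))) /
        (((l.factorial : ℕ) : ℝ) * (((k - 2 * l).factorial : ℕ) : ℝ)) * (2 * s) ^ (k - 2 * l)|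
        ≤ ((k + 1).factorial : ℝ) * 2 ^ k := by
    intro l _
    have hP := P_nonneg k l
    have hPle := P_le k l
    unfold P at hP hPle
    have hfac : (1 : ℝ) ≤ ((l.factorial : ℕ) : ℝ) * (((k - 2 * l).factorial : ℕ) : ℝ) := by
      have h1 : (1 : ℝ) ≤ ((l.factorial : ℕ) : ℝ) := by exact_mod_cast l.factorial_pos
      have h2 : (1 : ℝ) ≤ (((k - 2 * l).factorial : ℕ) : ℝ) := by
        exact_mod_cast (k - 2 * l).factorial_pos
      nlinarith
    have h2s : |2 * s| ≤ 2 := by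
      rw [abs_mul, abs_two]; linarith
    rw [abs_mul, abs_div, abs_mul, abs_pow, abs_pow, abs_neg, abs_one, one_pow, one_mul,
      abs_of_nonneg hP, abs_of_pos (by linarith : (0 : ℝ) < ((l.factorial : ℕ) : ℝ) * (((k - 2 * l).factorial : ℕ) : ℝ))]
    calc (∏ j ∈ Finset.range (k - l), ((3 : ℝ) / 2 + (j : ℝ))) /
          (((l.factorial : ℕ) : ℝ) * (((k - 2 * l).factorial : ℕ) : ℝ)) * |2 * s| ^ (k - 2 * l)
        ≤ (∏ j ∈ Finset.range (k - l), ((3 : ℝ) / 2 + (j : ℝ))) * 2 ^ (k - 2 * l) := by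
          apply mul_le_mul
          · exact div_le_self hP hfac
          · exact pow_le_pow_left₀ (abs_nonneg _) h2s _
          · positivity
          · exact hP
      _ ≤ ((k + 1).factorial : ℝ) * 2 ^ k := by
          apply mul_le_mul hPle
          · exact pow_le_pow_right₀ (by norm_num) (by omega)
          · positivity
          · positivity
  calc |∑ l ∈ Finset.range (k / 2 + 1), (-1 : ℝ) ^ l *
        (∏ j ∈ Finset.range (k - l), ((3 : ℝ) / 2 + (j : ℝ))) /
        (((l.factorial : ℕ) : ℝ) * (((k - 2 * l).factorial : ℕ) : ℝ)) * (2 * s) ^ (k - 2 * l)|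
      ≤ ∑ l ∈ Finset.range (k / 2 + 1), |(-1 : ℝ) ^ l *
        (∏ j ∈ Finset.range (k - l), ((3 : ℝ) / 2 + (j : ℝ))) /
        (((l.factorial : ℕ) : ℝ) * (((k - 2 * l).factorial : ℕ) : ℝ)) * (2 * s) ^ (k - 2 * l)| :=
        Finset.abs_sum_le_sum_abs _ _
    _ ≤ ∑ l ∈ Finset.range (k / 2 + 1), ((k + 1).factorial : ℝ) * 2 ^ k :=
        Finset.sum_le_sum hterm
    _ = ((k / 2 + 1 : ℕ) : ℝ) * (((k + 1).factorial : ℝ) * 2 ^ k) := by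
        rw [Finset.sum_const, Finset.card_range, nsmul_eq_mul]
    _ ≤ ((k + 2 : ℕ) : ℝ) * (((k + 1).factorial : ℝ) * 2 ^ k) := by
        apply mul_le_mul_of_nonneg_right _ (by positivity)
        exact_mod_cast (by omega : k / 2 + 1 ≤ k + 2)
    _ = ((k + 2).factorial : ℝ) * 2 ^ k := by
        rw [Nat.factorial_succ (k + 1)]
        push_cast
        ring


/-! ### domination and the uniform tail bound -/

/-- Dominating sequence `d k = e^{4-k(k+3)} (k+3)! 2^k`. -/
def d (k : ℕ) : ℝ := Real.exp (4 - (k : ℝ) * ((k : ℝ) + 3)) * ((k + 3).factorial : ℝ) * 2 ^ k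

theorem d_pos (k : ℕ) : 0 < d k := by
  unfold d; positivity

theorem abs_a_le {τ s : ℝ} (hτ : 1 ≤ τ) (hs : |s| ≤ 1) (k : ℕ) : |a k τ s| ≤ d k := by
  unfold a d
  have h3 : (0 : ℝ) < (2 * (k : ℝ) + 3) / 3 := by positivity
  rw [abs_mul, abs_mul, abs_of_pos (Real.exp_pos _), abs_of_pos h3]
  have hT := abs_T_le k hs
  have hk0 : (0 : ℝ) ≤ (k : ℝ) := by positivity
  have hexp : Real.exp (-((k : ℝ) * ((k : ℝ) + 3)) * τ) ≤
      Real.exp (4 - (k : ℝ) * ((k : ℝ) + 3)) := by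
    apply Real.exp_le_exp.mpr
    have hk : (0 : ℝ) ≤ (k : ℝ) * ((k : ℝ) + 3) := by positivity
    nlinarith
  have hX : (0 : ℝ) ≤ ((k + 2).factorial : ℝ) * 2 ^ k := by positivity
  have hcoef : (2 * (k : ℝ) + 3) / 3 * (((k + 2).factorial : ℝ) * 2 ^ k) ≤
      ((k + 3).factorial : ℝ) * 2 ^ k := by
    rw [Nat.factorial_succ (k + 2)]
    push_cast
    have h4 : (0 : ℝ) ≤ (k : ℝ) + 2 + 1 - (2 * (k : ℝ) + 3) / 3 := by linarith
    nlinarith [mul_nonneg h4 hX]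
  calc Real.exp (-((k : ℝ) * ((k : ℝ) + 3)) * τ) * ((2 * (k : ℝ) + 3) / 3) * |T k s|
      ≤ Real.exp (4 - (k : ℝ) * ((k : ℝ) + 3)) * ((2 * (k : ℝ) + 3) / 3) *
          (((k + 2).factorial : ℝ) * 2 ^ k) := by
        apply mul_le_mul (mul_le_mul_of_nonneg_right hexp h3.le) hT (abs_nonneg _)
        positivity
    _ = Real.exp (4 - (k : ℝ) * ((k : ℝ) + 3)) *
          ((2 * (k : ℝ) + 3) / 3 * (((k + 2).factorial : ℝ) * 2 ^ k)) := by ring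
    _ ≤ Real.exp (4 - (k : ℝ) * ((k : ℝ) + 3)) * (((k + 3).factorial : ℝ) * 2 ^ k) :=
        mul_le_mul_of_nonneg_left hcoef (Real.exp_pos _).le
    _ = Real.exp (4 - (k : ℝ) * ((k : ℝ) + 3)) * ((k + 3).factorial : ℝ) * 2 ^ k := by ring

theorem abs_a_succ_le {τ s : ℝ} (hτ : 1 ≤ τ) (hs : |s| ≤ 1) (k : ℕ) :
    |a (k + 1) τ s| ≤ Real.exp (-4 * τ) * d (k + 1) := by
  unfold a d
  have h3 : (0 : ℝ) < (2 * ((k + 1 : ℕ) : ℝ) + 3) / 3 := by positivity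
  rw [abs_mul, abs_mul, abs_of_pos (Real.exp_pos _), abs_of_pos h3]
  have hT := abs_T_le (k + 1) hs
  have hk0 : (0 : ℝ) ≤ (k : ℝ) := by positivity
  have hexp : Real.exp (-(((k + 1 : ℕ) : ℝ) * (((k + 1 : ℕ) : ℝ) + 3)) * τ) ≤
      Real.exp (-4 * τ) * Real.exp (4 - ((k + 1 : ℕ) : ℝ) * (((k + 1 : ℕ) : ℝ) + 3)) := by
    rw [← Real.exp_add]
    apply Real.exp_le_exp.mpr
    push_cast
    have hm : (0 : ℝ) ≤ ((k : ℝ) + 1) * ((k : ℝ) + 1 + 3) - 4 := by nlinarith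
    nlinarith [mul_nonneg hm (sub_nonneg.mpr hτ)]
  have hX : (0 : ℝ) ≤ ((k + 1 + 2).factorial : ℝ) * 2 ^ (k + 1) := by positivity
  have hcoef : (2 * ((k + 1 : ℕ) : ℝ) + 3) / 3 * (((k + 1 + 2).factorial : ℝ) * 2 ^ (k + 1)) ≤
      ((k + 1 + 3).factorial : ℝ) * 2 ^ (k + 1) := by
    rw [Nat.factorial_succ (k + 1 + 2)]
    push_cast
    have h4 : (0 : ℝ) ≤ (k : ℝ) + 1 + 2 + 1 - (2 * ((k : ℝ) + 1) + 3) / 3 := by linarith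
    nlinarith [mul_nonneg h4 hX]
  have hE := (Real.exp_pos (-4 * τ)).le
  calc Real.exp (-(((k + 1 : ℕ) : ℝ) * (((k + 1 : ℕ) : ℝ) + 3)) * τ) *
        ((2 * ((k + 1 : ℕ) : ℝ) + 3) / 3) * |T (k + 1) s|
      ≤ (Real.exp (-4 * τ) * Real.exp (4 - ((k + 1 : ℕ) : ℝ) * (((k + 1 : ℕ) : ℝ) + 3))) *
          ((2 * ((k + 1 : ℕ) : ℝ) + 3) / 3) * (((k + 1 + 2).factorial : ℝ) * 2 ^ (k + 1)) := by
        apply mul_le_mul (mul_le_mul_of_nonneg_right hexp h3.le) hT (abs_nonneg _)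
        positivity
    _ = Real.exp (-4 * τ) * (Real.exp (4 - ((k + 1 : ℕ) : ℝ) * (((k + 1 : ℕ) : ℝ) + 3)) *
          ((2 * ((k + 1 : ℕ) : ℝ) + 3) / 3 * (((k + 1 + 2).factorial : ℝ) * 2 ^ (k + 1)))) := by
        ring
    _ ≤ Real.exp (-4 * τ) * (Real.exp (4 - ((k + 1 : ℕ) : ℝ) * (((k + 1 : ℕ) : ℝ) + 3)) *
          (((k + 1 + 3).factorial : ℝ) * 2 ^ (k + 1))) := by
        apply mul_le_mul_of_nonneg_left _ hE
        exact mul_le_mul_of_nonneg_left hcoef (Real.exp_pos _).le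
    _ = Real.exp (-4 * τ) * (Real.exp (4 - ((k + 1 : ℕ) : ℝ) * (((k + 1 : ℕ) : ℝ) + 3)) *
          ((k + 1 + 3).factorial : ℝ) * 2 ^ (k + 1)) := by ring

theorem summable_d : Summable d := by
  refine summable_of_ratio_norm_eventually_le (r := 1 / 2) (by norm_num) ?_
  rw [Filter.eventually_atTop]
  refine ⟨2, fun n hn => ?_⟩
  rw [Real.norm_of_nonneg (d_pos _).le, Real.norm_of_nonneg (d_pos _).le]
  unfold d
  have hexp : Real.exp (4 - ((n + 1 : ℕ) : ℝ) * (((n + 1 : ℕ) : ℝ) + 3)) =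
      Real.exp (4 - (n : ℝ) * ((n : ℝ) + 3)) * Real.exp (-(2 * (n : ℝ) + 4)) := by
    rw [← Real.exp_add]; congr 1; push_cast; ring
  have hfac : (((n + 1 + 3).factorial : ℕ) : ℝ) = ((n : ℝ) + 4) * ((n + 3).factorial : ℝ) := by
    rw [show n + 1 + 3 = (n + 3) + 1 by ring, Nat.factorial_succ]; push_cast; ring
  have hkey : ((n : ℝ) + 4) * Real.exp (-(2 * (n : ℝ) + 4)) * 2 ≤ 1 / 2 := by
    have h1 : (n : ℝ) + 3 ≤ Real.exp ((n : ℝ) + 2) := by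
      have := Real.add_one_le_exp ((n : ℝ) + 2); linarith
    have hn' : (2 : ℝ) ≤ n := by exact_mod_cast hn
    have hpos := Real.exp_pos ((n : ℝ) + 2)
    have hE : Real.exp (2 * (n : ℝ) + 4) = Real.exp ((n : ℝ) + 2) * Real.exp ((n : ℝ) + 2) := by
      rw [← Real.exp_add]; ring_nf
    have h5 : ((n : ℝ) + 3) * ((n : ℝ) + 3) ≤ Real.exp ((n : ℝ) + 2) * Real.exp ((n : ℝ) + 2) :=
      mul_le_mul h1 h1 (by positivity) hpos.le
    have h4 : 4 * ((n : ℝ) + 4) ≤ Real.exp (2 * (n : ℝ) + 4) := by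
      rw [hE]; nlinarith
    have hpos2 := Real.exp_pos (2 * (n : ℝ) + 4)
    rw [Real.exp_neg, show ((n : ℝ) + 4) * (Real.exp (2 * ↑n + 4))⁻¹ * 2 =
      (2 * ((n : ℝ) + 4)) / Real.exp (2 * ↑n + 4) by ring, div_le_iff₀ hpos2]
    linarith
  rw [hexp, hfac]
  have hA : (0 : ℝ) ≤ Real.exp (4 - (n : ℝ) * ((n : ℝ) + 3)) * ((n + 3).factorial : ℝ) * 2 ^ n := by
    positivity
  calc Real.exp (4 - ↑n * (↑n + 3)) * Real.exp (-(2 * ↑n + 4)) * ((↑n + 4) * ↑(n + 3).factorial) *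
        2 ^ (n + 1)
      = (((n : ℝ) + 4) * Real.exp (-(2 * (n : ℝ) + 4)) * 2) *
          (Real.exp (4 - ↑n * (↑n + 3)) * ↑(n + 3).factorial * 2 ^ n) := by ring
    _ ≤ (1 / 2) * (Real.exp (4 - ↑n * (↑n + 3)) * ↑(n + 3).factorial * 2 ^ n) :=
        mul_le_mul_of_nonneg_right hkey hA

/-- `D = Σ_k d (k+1)`. -/
def D : ℝ := ∑' k, d (k + 1)

theorem summable_d_succ : Summable (fun k => d (k + 1)) := (summable_nat_add_iff 1).mpr summable_d

theorem D_nonneg : 0 ≤ D := tsum_nonneg fun k => (d_pos (k + 1)).le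

theorem summable_a {τ s : ℝ} (hτ : 1 ≤ τ) (hs : |s| ≤ 1) : Summable (fun k => a k τ s) :=
  Summable.of_norm_bounded summable_d (fun k => by rw [Real.norm_eq_abs]; exact abs_a_le hτ hs k)

/-- Uniform tail bound: `|S(τ,s) - 1| ≤ e^{-4τ} D` for `τ ≥ 1`, `|s| ≤ 1`. -/
theorem abs_S_sub_one_le {τ s : ℝ} (hτ : 1 ≤ τ) (hs : |s| ≤ 1) :
    |S τ s - 1| ≤ Real.exp (-4 * τ) * D := by
  have hsum := summable_a hτ hs
  have hsplit : S τ s = a 0 τ s + ∑' k, a (k + 1) τ s := hsum.tsum_eq_zero_add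
  rw [hsplit, a_zero, add_sub_cancel_left]
  have hg : HasSum (fun k => Real.exp (-4 * τ) * d (k + 1)) (Real.exp (-4 * τ) * D) :=
    summable_d_succ.hasSum.mul_left _
  have := tsum_of_norm_bounded hg (fun k => by rw [Real.norm_eq_abs]; exact abs_a_succ_le hτ hs k)
  rwa [Real.norm_eq_abs] at this

/-- The kernel product is eventually `≥ 1 - ε`, uniformly on `|s| ≤ 1`, `|u| ≤ R`. -/
theorem kernel_lower {ε R : ℝ} (hε : 0 < ε) (hR : 0 ≤ R) :
    ∃ τ : ℝ, 1 ≤ τ ∧ ∀ s u : ℝ, |s| ≤ 1 → |u| ≤ R →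
      1 - ε ≤ S τ s * Real.exp (-(u ^ 2) / (4 * τ)) := by
  set ε' := min ε 1 with hε'
  have hε'0 : 0 < ε' := lt_min hε one_pos
  have hε'1 : ε' ≤ 1 := min_le_right _ _
  have hε'ε : ε' ≤ ε := min_le_left _ _
  refine ⟨max 1 (max (D / ε') (R ^ 2 / ε')), le_max_left _ _, fun s u hs hu => ?_⟩
  set τ := max 1 (max (D / ε') (R ^ 2 / ε')) with hτdef
  have hτ1 : 1 ≤ τ := le_max_left _ _
  have hτ0 : 0 < τ := by linarith
  have hDτ : D ≤ ε' * τ := by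
    have : D / ε' ≤ τ := (le_max_left _ _).trans (le_max_right _ _)
    rwa [div_le_iff₀ hε'0, mul_comm] at this
  have hRτ : R ^ 2 ≤ ε' * τ := by
    have : R ^ 2 / ε' ≤ τ := (le_max_right _ _).trans (le_max_right _ _)
    rwa [div_le_iff₀ hε'0, mul_comm] at this
  -- e^{-4τ} ≤ 1/(4τ)
  have hexp : Real.exp (-4 * τ) * D ≤ ε' / 4 := by
    have h1 : 4 * τ + 1 ≤ Real.exp (4 * τ) := Real.add_one_le_exp _
    have hpos := Real.exp_pos (4 * τ)
    have h2 : Real.exp (-4 * τ) = (Real.exp (4 * τ))⁻¹ := by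
      rw [← Real.exp_neg]; ring_nf
    rw [h2, inv_mul_eq_div, div_le_iff₀ hpos]
    nlinarith
  have hS : 1 - ε' / 4 ≤ S τ s := by
    have := (abs_le.mp (abs_S_sub_one_le hτ1 hs)).1
    linarith
  have hE : 1 - ε' / 4 ≤ Real.exp (-(u ^ 2) / (4 * τ)) := by
    have h1 : 1 - u ^ 2 / (4 * τ) ≤ Real.exp (-(u ^ 2 / (4 * τ))) := Real.one_sub_le_exp_neg _
    have h2 : u ^ 2 ≤ R ^ 2 := by
      have hu0 : |u| ≤ |R| := by rwa [abs_of_nonneg hR]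
      exact sq_le_sq.mpr hu0
    have h3 : u ^ 2 / (4 * τ) ≤ ε' / 4 := by
      rw [div_le_iff₀ (by linarith)]
      nlinarith
    rw [neg_div] 
    linarith
  have hS0 : (0 : ℝ) ≤ 1 - ε' / 4 := by linarith
  calc 1 - ε ≤ 1 - ε' := by linarith
    _ ≤ (1 - ε' / 4) * (1 - ε' / 4) := by nlinarith
    _ ≤ S τ s * Real.exp (-(u ^ 2) / (4 * τ)) := mul_le_mul hS hE hS0 (by linarith)


/-! ### entropy ≥ normalised Hausdorff area -/

/-- The centre `e₀ = (1,0,0,0,0,0) ∈ N` used for the lower bound. -/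
def e₀ : E⁶ := EuclideanSpace.single 0 1

theorem e₀_mem : ∑ i : Fin 5, e₀ (Fin.castSucc i) ^ 2 = 1 := by
  simp [e₀, Fin.castSucc_eq_zero_iff]

theorem e₀_five : e₀ 5 = 0 := by
  simp [e₀]

theorem inner_e₀ (z : E⁶) : ∑ i : Fin 5, z (Fin.castSucc i) * e₀ (Fin.castSucc i) = z 0 := by
  simp [e₀, Fin.castSucc_eq_zero_iff]

/-- On the cylinder the first coordinate is at most `1` in absolute value. -/
theorem abs_apply_zero_le_one {z : E⁶} (hz : ∑ i : Fin 5, z (Fin.castSucc i) ^ 2 = 1) :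
    |z 0| ≤ 1 := by
  have h : z 0 ^ 2 ≤ 1 := by
    rw [← hz]
    have : z 0 ^ 2 = z (Fin.castSucc 0) ^ 2 := rfl
    rw [this]
    exact Finset.single_le_sum (f := fun i : Fin 5 => z (Fin.castSucc i) ^ 2)
      (fun i _ => sq_nonneg _) (Finset.mem_univ 0)
  exact (sq_le_one_iff_abs_le_one _).mp h

/-- **Entropy ≥ normalised area.** For a measurable `A ⊆ N` of bounded height, the typed cylinder
entropy is at least `μH[4](A) / μH[4](S⁴)` (large-scale limit of the functional at centre `e₀`:
the Gegenbauer series tends to `1` uniformly and the Gaussian factor to `1`). -/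
theorem measure_le_cylEntropy (A : Set E⁶)
    (hN : A ⊆ {z : E⁶ | ∑ i : Fin 5, z (Fin.castSucc i) ^ 2 = 1}) (hAm : MeasurableSet A)
    (hb : ∃ R : ℝ, ∀ z ∈ A, |z 5| ≤ R) :
    (μH[4] (Metric.sphere (0 : EuclideanSpace ℝ (Fin 5)) 1))⁻¹ * μH[4] A ≤ cylEntropy A := by
  obtain ⟨R₀, hR₀⟩ := hb
  set R := max R₀ 0 with hRdef
  have hR : 0 ≤ R := le_max_right _ _
  have hzR : ∀ z ∈ A, |z 5| ≤ R := fun z hz => (hR₀ z hz).trans (le_max_left _ _)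
  refine ENNReal.le_of_forall_lt_one_mul_le fun c hc => ?_
  have hc' : c ≠ ⊤ := ne_top_of_lt hc
  have ht1 : c.toReal < 1 := by
    have := ENNReal.toReal_strict_mono ENNReal.one_ne_top hc
    simpa using this
  obtain ⟨τ, hτ1, hτ⟩ := kernel_lower (ε := 1 - c.toReal) (by linarith) hR
  have hτ0 : 0 < τ := by linarith
  have hpt : ∀ z ∈ A, ENNReal.ofReal (1 - (1 - c.toReal)) ≤
      ENNReal.ofReal (S τ (∑ i : Fin 5, z (Fin.castSucc i) * e₀ (Fin.castSucc i)) *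
        Real.exp (-((z 5 - e₀ 5) ^ 2) / (4 * τ))) := by
    intro z hz
    apply ENNReal.ofReal_le_ofReal
    rw [inner_e₀, e₀_five, sub_zero]
    exact hτ (z 0) (z 5) (abs_apply_zero_le_one (hN hz)) (hzR z hz)
  have hct : ENNReal.ofReal (1 - (1 - c.toReal)) = c := by
    rw [sub_sub_cancel, ENNReal.ofReal_toReal hc']
  calc c * ((μH[4] (Metric.sphere (0 : EuclideanSpace ℝ (Fin 5)) 1))⁻¹ * μH[4] A)
      = (μH[4] (Metric.sphere (0 : EuclideanSpace ℝ (Fin 5)) 1))⁻¹ *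
          (ENNReal.ofReal (1 - (1 - c.toReal)) * μH[4] A) := by rw [hct]; ring
    _ = (μH[4] (Metric.sphere (0 : EuclideanSpace ℝ (Fin 5)) 1))⁻¹ *
          ∫⁻ _ in A, ENNReal.ofReal (1 - (1 - c.toReal)) ∂μH[4] := by rw [setLIntegral_const]
    _ ≤ (μH[4] (Metric.sphere (0 : EuclideanSpace ℝ (Fin 5)) 1))⁻¹ *
          ∫⁻ z in A, ENNReal.ofReal (S τ (∑ i : Fin 5, z (Fin.castSucc i) * e₀ (Fin.castSucc i)) *
            Real.exp (-((z 5 - e₀ 5) ^ 2) / (4 * τ))) ∂μH[4] :=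
        mul_le_mul_of_nonneg_left (setLIntegral_mono' hAm hpt) (by simp)
    _ ≤ cylEntropy A := by
        rw [cylEntropy_eq]
        exact le_iSup_of_le e₀ (le_iSup_of_le e₀_mem (le_iSup_of_le τ (le_iSup_of_le hτ0 le_rfl)))

/-- The same for the image of a compact space (the shape of the items: `A = range ι`). -/
theorem measure_range_le_cylEntropy {M : Type*} [TopologicalSpace M] [CompactSpace M]
    {ι : M → E⁶} (hι : Continuous ι) (hN : ∀ x, ∑ i : Fin 5, ι x (Fin.castSucc i) ^ 2 = 1) :
    (μH[4] (Metric.sphere (0 : EuclideanSpace ℝ (Fin 5)) 1))⁻¹ * μH[4] (Set.range ι) ≤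
      cylEntropy (Set.range ι) := by
  have hK : IsCompact (Set.range ι) := isCompact_range hι
  apply measure_le_cylEntropy
  · rintro _ ⟨x, rfl⟩; exact hN x
  · exact hK.isClosed.measurableSet
  · have hcont : Continuous fun z : E⁶ => |z 5| :=
      (EuclideanSpace.proj (5 : Fin 6)).continuous.abs
    obtain ⟨R, hR⟩ := (hK.image hcont).isBounded.subset_closedBall 0 |>.imp fun R h => h
    refine ⟨R, fun z hz => ?_⟩
    have := hR ⟨z, hz, rfl⟩
    simpa using this


/-- The coordinate projection `ℝ⁶ → ℝ⁵` forgetting the height. -/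
def proj (z : E⁶) : E⁵ := WithLp.toLp 2 (fun i : Fin 5 => z (Fin.castSucc i))

@[simp] theorem proj_apply (z : E⁶) (i : Fin 5) : proj z i = z (Fin.castSucc i) := rfl

/-- The lift `ℝ⁵ × ℝ → ℝ⁶`. -/
def lift (q : E⁵) (t : ℝ) : E⁶ := WithLp.toLp 2 (Fin.snoc (fun i : Fin 5 => q i) t)

@[simp] theorem lift_castSucc (q : E⁵) (t : ℝ) (i : Fin 5) : lift q t (Fin.castSucc i) = q i := by
  simp [lift]

@[simp] theorem lift_five (q : E⁵) (t : ℝ) : lift q t 5 = t := by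
  change Fin.snoc (α := fun _ : Fin 6 => ℝ) (fun i : Fin 5 => q i) t (Fin.last 5) = t
  exact Fin.snoc_last (α := fun _ : Fin 6 => ℝ) _ _

theorem proj_lift (q : E⁵) (t : ℝ) : proj (lift q t) = q := by
  ext i; simp

/-- The projection is `1`-Lipschitz. -/
theorem lipschitz_proj : LipschitzWith 1 proj := by
  refine LipschitzWith.of_dist_le_mul fun z w => ?_
  rw [EuclideanSpace.dist_eq, EuclideanSpace.dist_eq, NNReal.coe_one, one_mul]
  apply Real.sqrt_le_sqrt
  rw [Fin.sum_univ_castSucc (f := fun j : Fin 6 => dist (z j) (w j) ^ 2)]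
  simp only [proj_apply]
  have : 0 ≤ dist (z (Fin.last 5)) (w (Fin.last 5)) ^ 2 := sq_nonneg _
  linarith

/-- On the unit sphere of `ℝ⁵` the squared coordinates sum to `1`. -/
theorem sum_sq_eq_one_of_mem_sphere {q : E⁵} (hq : q ∈ Metric.sphere (0 : E⁵) 1) :
    ∑ i : Fin 5, q i ^ 2 = 1 := by
  rw [mem_sphere_zero_iff_norm] at hq
  have h := EuclideanSpace.real_norm_sq_eq q
  rw [hq, one_pow] at h
  exact h.symm

/-- **AreaFloor** (support item stmt-SmoothPoincare4-7635): a separating set in the cylinder has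
`μH[4]`-measure at least that of the unit `S⁴`.  Stated for an arbitrary map `ι` (neither
smoothness nor even `range ι ⊆ N` is needed): the projection `ℝ⁶ → ℝ⁵` is `1`-Lipschitz and its image of `range ι` contains the
whole unit sphere, since a missed point `q` gives the vertical segment `{q} × [-|R|, |R|]` in
`N ∖ range ι` joining the two ends. -/
theorem areaFloor_of_separates {M : Type*} (ι : M → E⁶)
    (hsep : ∃ R : ℝ, ∀ a b : EuclideanSpace ℝ (Fin 6), ∑ i : Fin 5, a (Fin.castSucc i) ^ 2 = 1 →
      ∑ i : Fin 5, b (Fin.castSucc i) ^ 2 = 1 → a 5 ≤ -R → R ≤ b 5 →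
      ¬ JoinedIn ({z : EuclideanSpace ℝ (Fin 6) | ∑ i : Fin 5, z (Fin.castSucc i) ^ 2 = 1} \
        Set.range ι) a b) :
    μH[4] (Metric.sphere (0 : EuclideanSpace ℝ (Fin 5)) 1) ≤ μH[4] (Set.range ι) := by
  obtain ⟨R, hR⟩ := hsep
  -- the sphere is contained in the projection of the image
  have hsub : Metric.sphere (0 : E⁵) 1 ⊆ proj '' Set.range ι := by
    intro q hq
    by_contra hmiss
    have hq1 := sum_sq_eq_one_of_mem_sphere hq
    -- the two endpoints
    have hmemN : ∀ t : ℝ, ∑ i : Fin 5, lift q t (Fin.castSucc i) ^ 2 = 1 := by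
      intro t; simpa using hq1
    have hnot : ∀ t : ℝ, lift q t ∉ Set.range ι := by
      rintro t ⟨x, hx⟩
      exact hmiss ⟨ι x, ⟨x, rfl⟩, by rw [hx, proj_lift]⟩
    apply hR (lift q (-|R|)) (lift q |R|) (hmemN _) (hmemN _)
      (by rw [lift_five]; exact neg_le_neg (le_abs_self R)) (by rw [lift_five]; exact le_abs_self R)
    apply JoinedIn.of_segment_subset
    rw [segment_eq_image']
    rintro _ ⟨θ, hθ, rfl⟩
    have hpt : lift q (-|R|) + θ • (lift q |R| - lift q (-|R|)) = lift q (-|R| + θ * (|R| - -|R|)) := by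
      ext j
      refine Fin.lastCases ?_ (fun i => ?_) j
      · have : (Fin.last 5 : Fin 6) = 5 := rfl
        simp [this]
      · simp
    beta_reduce
    rw [hpt]
    exact ⟨hmemN _, hnot _⟩
  calc μH[4] (Metric.sphere (0 : E⁵) 1) ≤ μH[4] (proj '' Set.range ι) := measure_mono hsub
    _ ≤ ((1 : ℝ≥0) : ℝ≥0∞) ^ (4 : ℝ) * μH[4] (Set.range ι) :=
        lipschitz_proj.hausdorffMeasure_image_le (by norm_num) _
    _ = μH[4] (Set.range ι) := by simp

/-- The route's support item `AreaFloor`, proved. -/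
theorem areaFloor : AreaFloor := by
  intro M _ _ _ _ _ ι _ _ hsep
  exact areaFloor_of_separates ι hsep


/-! ### tightness at the bottom: the free interval starts at `1` -/

/-- `μH[4](S⁴) < ∞` (tree: `hausdorffMeasure_sphere_lt_top`). -/
theorem hausdorffMeasure_sphere_four_ne_top : μH[4] 𝕊⁴ ≠ ⊤ := by
  have h := Literature.MeasureTheory.Hausdorff.hausdorffMeasure_sphere_lt_top
    (E := EuclideanSpace ℝ (Fin 5)) (d := 4) (by simp) 1
  norm_num at h
  exact h.ne

/-- `μH[4](S⁴) ≠ 0` (tree: `μHE[4](S⁴) > 0` and `μHE = c • μH`). -/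
theorem hausdorffMeasure_sphere_four_ne_zero : μH[4] 𝕊⁴ ≠ 0 := by
  intro h0
  have hpos := Literature.MeasureTheory.Hausdorff.euclideanHausdorffMeasure_unitSphere_pos
    (E := EuclideanSpace ℝ (Fin 5)) (d := 4) (by simp) (by norm_num)
  rw [Measure.euclideanHausdorffMeasure_def, Measure.smul_apply] at hpos
  norm_num at hpos
  rw [h0] at hpos
  simp at hpos

/-- **Every cross-section has cylinder entropy `≥ 1`** (entropy ≥ normalised area ≥ 1 by
`AreaFloor`): for a compact `M`, a continuous `ι : M → N` whose image separates the ends. -/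
theorem one_le_cylEntropy {M : Type*} [TopologicalSpace M] [CompactSpace M] {ι : M → E⁶}
    (hι : Continuous ι) (hN : ∀ x, ∑ i : Fin 5, ι x (Fin.castSucc i) ^ 2 = 1)
    (hsep : ∃ R : ℝ, ∀ a b : EuclideanSpace ℝ (Fin 6), ∑ i : Fin 5, a (Fin.castSucc i) ^ 2 = 1 →
      ∑ i : Fin 5, b (Fin.castSucc i) ^ 2 = 1 → a 5 ≤ -R → R ≤ b 5 →
      ¬ JoinedIn ({z : EuclideanSpace ℝ (Fin 6) | ∑ i : Fin 5, z (Fin.castSucc i) ^ 2 = 1} \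
        Set.range ι) a b) :
    1 ≤ cylEntropy (Set.range ι) := by
  have hfloor := areaFloor_of_separates ι hsep
  calc (1 : ℝ≥0∞) = (μH[4] 𝕊⁴)⁻¹ * μH[4] 𝕊⁴ :=
        (ENNReal.inv_mul_cancel hausdorffMeasure_sphere_four_ne_zero
          hausdorffMeasure_sphere_four_ne_top).symm
    _ ≤ (μH[4] 𝕊⁴)⁻¹ * μH[4] (Set.range ι) := mul_le_mul_of_nonneg_left hfloor (by simp)
    _ ≤ cylEntropy (Set.range ι) := measure_range_le_cylEntropy hι hN

/-- The crux-shaped version: for a homotopy 4-sphere `M` (compact by the proved tree theorem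
`compactSpace_of_homotopyEquiv_sphere_four_holds`) and a smooth separating embedding into `N`,
the typed cylinder entropy is `≥ 1`.  So the entropy hypothesis `< c` of `Rung c` is
UNSATISFIABLE for `c ≤ 1`: the free interval of the ladder genuinely starts at the ground state
`1` (`SliceCalibration` says the slice attains it). -/
theorem one_le_cylEntropy_of_homotopySphere (M : Type) [TopologicalSpace M] [T2Space M]
    [SecondCountableTopology M] [ChartedSpace (EuclideanSpace ℝ (Fin 4)) M]
    [IsManifold (𝓡 4) ∞ M] (e : M ≃ₕ 𝕊⁴) (ι : M → E⁶)
    (hι : Manifold.IsSmoothEmbedding (𝓡 4) (𝓡 6) ∞ ι)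
    (hN : ∀ x, ∑ i : Fin 5, ι x (Fin.castSucc i) ^ 2 = 1)
    (hsep : ∃ R : ℝ, ∀ a b : EuclideanSpace ℝ (Fin 6), ∑ i : Fin 5, a (Fin.castSucc i) ^ 2 = 1 →
      ∑ i : Fin 5, b (Fin.castSucc i) ^ 2 = 1 → a 5 ≤ -R → R ≤ b 5 →
      ¬ JoinedIn ({z : EuclideanSpace ℝ (Fin 6) | ∑ i : Fin 5, z (Fin.castSucc i) ^ 2 = 1} \
        Set.range ι) a b) :
    1 ≤ cylEntropy (Set.range ι) := by
  haveI : CompactSpace M :=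
    Literature.Topology.FourManifolds.compactSpace_of_homotopyEquiv_sphere_four_holds M e
  exact one_le_cylEntropy hι.isEmbedding.continuous hN hsep


/-! ## Consequences for the rung predicates -/

/-- **The bottom of the ladder is vacuous**: `Rung c` holds for every `c ≤ 1`, because no
cross-section of a homotopy sphere has typed entropy `< 1`. -/
theorem rung_of_le_one {c : ℝ≥0∞} (hc : c ≤ 1) : Rung c := by
  intro M _ _ _ _ _ e ι hι hN hsep hlt
  have h1 := one_le_cylEntropy_of_homotopySphere M e ι hι hN hsep
  exact absurd (lt_of_lt_of_le (lt_of_le_of_lt h1 hlt) hc) (lt_irrefl _)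

/-- No homotopy 4-sphere has a cross-section of typed entropy `< 1`. -/
theorem not_hasCrossSectionBelow_of_le_one {c : ℝ≥0∞} (hc : c ≤ 1) (M : Type)
    [TopologicalSpace M] [T2Space M] [SecondCountableTopology M]
    [ChartedSpace (EuclideanSpace ℝ (Fin 4)) M] [IsManifold (𝓡 4) ∞ M] (e : M ≃ₕ 𝕊⁴) :
    ¬ HasCrossSectionBelow M c := by
  rintro ⟨ι, hι, hN, hsep, hlt⟩
  have h1 := one_le_cylEntropy_of_homotopySphere M e ι hι hN hsep
  exact absurd (lt_of_lt_of_le (lt_of_le_of_lt h1 hlt) hc) (lt_irrefl _)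

/-- Thin cross-sections have small area: under the crux's hypotheses,
`μH[4](range ι) / μH[4](S⁴) < c`. -/
theorem measure_lt_of_thin {c : ℝ≥0∞} (M : Type) [TopologicalSpace M] [T2Space M]
    [SecondCountableTopology M] [ChartedSpace (EuclideanSpace ℝ (Fin 4)) M]
    [IsManifold (𝓡 4) ∞ M] (e : M ≃ₕ 𝕊⁴) (ι : M → E⁶)
    (hι : Manifold.IsSmoothEmbedding (𝓡 4) (𝓡 6) ∞ ι) (hN : InCylinder ι)
    (hlt : cylEntropy (Set.range ι) < c) :
    (μH[4] 𝕊⁴)⁻¹ * μH[4] (Set.range ι) < c := by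
  haveI : CompactSpace M :=
    Literature.Topology.FourManifolds.compactSpace_of_homotopyEquiv_sphere_four_holds M e
  exact lt_of_le_of_lt (measure_range_le_cylEntropy hι.isEmbedding.continuous hN) hlt


/-! ## The slice: lower half of `SliceCalibration` (`1 ≤ λ_cyl(slice)`) -/

/-- The slice embedding `q ↦ (q, 0)` is an isometry `ℝ⁵ → ℝ⁶`. -/
theorem isometry_lift_zero : Isometry (fun q : E⁵ => lift q 0) := by
  refine Isometry.of_dist_eq fun q q' => ?_
  rw [EuclideanSpace.dist_eq, EuclideanSpace.dist_eq,
    Fin.sum_univ_castSucc (f := fun j : Fin 6 => dist (lift q 0 j) (lift q' 0 j) ^ 2)]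
  simp

/-- The slice at height `0` is the isometric image of the unit sphere of `ℝ⁵`. -/
theorem lift_zero_image_sphere : (fun q : E⁵ => lift q 0) '' Metric.sphere (0 : E⁵) 1 = slice 0 := by
  ext z
  constructor
  · rintro ⟨q, hq, rfl⟩
    refine ⟨?_, lift_five q 0⟩
    simpa using sum_sq_eq_one_of_mem_sphere hq
  · rintro ⟨hz1, hz5⟩
    refine ⟨proj z, ?_, ?_⟩
    · rw [mem_sphere_zero_iff_norm, EuclideanSpace.norm_eq]
      simp only [proj_apply, Real.norm_eq_abs, sq_abs]
      rw [hz1, Real.sqrt_one]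
    · ext j
      refine Fin.lastCases ?_ (fun i => ?_) j
      · have h5 : (Fin.last 5 : Fin 6) = 5 := rfl
        rw [h5, lift_five, hz5]
      · simp

/-- `μH[4](slice) = μH[4](S⁴)`. -/
theorem hausdorffMeasure_slice_zero : μH[4] (slice 0) = μH[4] 𝕊⁴ := by
  rw [← lift_zero_image_sphere]
  exact isometry_lift_zero.hausdorffMeasure_image (Or.inl (by norm_num)) _

/-- **Lower half of `SliceCalibration`** (item 7634 says `= 1`): the slice has typed cylinder
entropy `≥ 1` (entropy ≥ normalised area = 1).  The upper half (`≤ 1`, Funk–Hecke: only the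
`k = 0` Gegenbauer mode survives integration) is the genuinely open calculus. -/
theorem one_le_cylEntropy_slice : 1 ≤ cylEntropy (slice 0) := by
  have hle := measure_le_cylEntropy (slice 0) (fun z hz => hz.1)
    ((isClosed_eq (by fun_prop) continuous_const).inter
      (isClosed_eq ((EuclideanSpace.proj (5 : Fin 6)).continuous) continuous_const)).measurableSet
    ⟨0, fun z hz => by rw [hz.2, abs_zero]⟩
  rw [hausdorffMeasure_slice_zero, ENNReal.inv_mul_cancel hausdorffMeasure_sphere_four_ne_zero
    hausdorffMeasure_sphere_four_ne_top] at hle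
  exact hle


/-! ## Two slices: `M ≃ₕ S⁴` and the entropy bound are JOINTLY load-bearing

Uses the tree file `Literature.Geometry.Manifold.CylinderSlice` (written by the sibling standing disprover of
`SliceIsolation`, refuter-cdisprove-stmt-SmoothPoincare4-7632-0): `sliceMap`, `twoSlices`,
`isSmoothEmbedding_twoSlices`, `sum_sq_twoSlices`, `range_twoSlices`, `range_sliceMap`,
`isEmpty_diffeomorph_twoSpheres` (my `separatesEnds_of_slice_subset` / `sum_sphere_not_diffeomorphic`
above duplicate its lemmas and are kept only for self-containedness). -/

open Literature.Geometry.Manifold.CylinderSlice in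
/-- The crux with BOTH the homotopy hypothesis and the entropy hypothesis dropped. -/
def RungWithoutHomotopyEntropy : Prop :=
  ∀ (M : Type) [TopologicalSpace M] [T2Space M] [SecondCountableTopology M]
    [ChartedSpace (EuclideanSpace ℝ (Fin 4)) M] [IsManifold (𝓡 4) ∞ M],
    ∀ ι : M → E⁶, Manifold.IsSmoothEmbedding (𝓡 4) (𝓡 6) ∞ ι → InCylinder ι →
    SeparatesEnds (Set.range ι) → Nonempty (M ≃ₘ⟮𝓡 4, 𝓡 4⟯ 𝕊⁴)

open Literature.Geometry.Manifold.CylinderSlice in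
/-- **Two slices kill the doubly-weakened crux** (sorry-free): `M = S⁴ ⊔ S⁴`, `ι = twoSlices`
(heights `0` and `1`) is a smooth embedding into `N` separating the ends, and `S⁴ ⊔ S⁴ ≄ S⁴`. -/
theorem rungWithoutHomotopyEntropy_false : ¬ RungWithoutHomotopyEntropy := by
  intro h
  have hsep : SeparatesEnds (Set.range twoSlices) := by
    apply separatesEnds_of_slice_subset (h := 0)
    rw [range_twoSlices]
    exact Set.subset_union_left
  obtain ⟨d⟩ := h (𝕊⁴ ⊕ 𝕊⁴) twoSlices isSmoothEmbedding_twoSlices sum_sq_twoSlices hsep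
  exact isEmpty_diffeomorph_twoSpheres.false d

/-- The slice embedding at any height is an isometry `ℝ⁵ → ℝ⁶`. -/
theorem isometry_lift (c : ℝ) : Isometry (fun q : E⁵ => lift q c) := by
  refine Isometry.of_dist_eq fun q q' => ?_
  rw [EuclideanSpace.dist_eq, EuclideanSpace.dist_eq,
    Fin.sum_univ_castSucc (f := fun j : Fin 6 => dist (lift q c j) (lift q' c j) ^ 2)]
  simp

/-- The slice at height `c` is the isometric image of the unit sphere. -/
theorem lift_image_sphere (c : ℝ) : (fun q : E⁵ => lift q c) '' Metric.sphere (0 : E⁵) 1 = slice c := by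
  ext z
  constructor
  · rintro ⟨q, hq, rfl⟩
    refine ⟨?_, lift_five q c⟩
    simpa using sum_sq_eq_one_of_mem_sphere hq
  · rintro ⟨hz1, hz5⟩
    refine ⟨proj z, ?_, ?_⟩
    · rw [mem_sphere_zero_iff_norm, EuclideanSpace.norm_eq]
      simp only [proj_apply, Real.norm_eq_abs, sq_abs]
      rw [hz1, Real.sqrt_one]
    · ext j
      refine Fin.lastCases ?_ (fun i => ?_) j
      · have h5 : (Fin.last 5 : Fin 6) = 5 := rfl
        rw [h5, lift_five, hz5]
      · simp

/-- `μH[4](slice c) = μH[4](S⁴)` for every height. -/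
theorem hausdorffMeasure_slice (c : ℝ) : μH[4] (slice c) = μH[4] 𝕊⁴ := by
  rw [← lift_image_sphere c]
  exact (isometry_lift c).hausdorffMeasure_image (Or.inl (by norm_num)) _

open Literature.Geometry.Manifold.CylinderSlice in
/-- **Why two slices do NOT refute the rung at `4/e`**: the two-slice configuration has typed
cylinder entropy `≥ 2` (entropy ≥ normalised area = 2), and `4/e < 2`.  So the entropy hypothesis
is exactly what excludes the disconnected witness; refuting `RungWithoutHomotopy (4/e)` needs the
small-sphere / thin-handle witness of the near-miss above. -/
theorem two_le_cylEntropy_twoSlices : 2 ≤ cylEntropy (Set.range twoSlices) := by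
  have hrange : Set.range twoSlices = slice 0 ∪ slice 1 := range_twoSlices
  have hdisj : Disjoint (slice 0) (slice 1) := by
    rw [Set.disjoint_iff]
    rintro z ⟨h0, h1⟩
    exact one_ne_zero (h1.2.symm.trans h0.2)
  have hmeas : ∀ c : ℝ, MeasurableSet (slice c) := fun c =>
    ((isClosed_eq (by fun_prop) continuous_const).inter
      (isClosed_eq ((EuclideanSpace.proj (5 : Fin 6)).continuous) continuous_const)).measurableSet
  have hμ : μH[4] (Set.range twoSlices) = 2 * μH[4] 𝕊⁴ := by
    rw [hrange, measure_union hdisj (hmeas 1), hausdorffMeasure_slice, hausdorffMeasure_slice, two_mul]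
  have hle := measure_le_cylEntropy (Set.range twoSlices)
    (by rw [hrange]; rintro z (hz | hz) <;> exact hz.1)
    (by rw [hrange]; exact (hmeas 0).union (hmeas 1))
    ⟨1, by
      rw [hrange]
      rintro z (hz | hz)
      · rw [hz.2, abs_zero]; exact zero_le_one
      · rw [hz.2, abs_one]⟩
  rw [hμ, ← mul_assoc, mul_comm ((μH[4] 𝕊⁴)⁻¹) 2, mul_assoc,
    ENNReal.inv_mul_cancel hausdorffMeasure_sphere_four_ne_zero hausdorffMeasure_sphere_four_ne_top,
    mul_one] at hle
  exact hle

/-- `4/e < 2`. -/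
theorem four_div_exp_one_lt_two : 4 / Real.exp 1 < 2 := by
  have h := Real.exp_one_gt_d9
  rw [div_lt_iff₀ (Real.exp_pos 1)]
  linarith

open Literature.Geometry.Manifold.CylinderSlice in
/-- The two-slice configuration violates the crux's entropy hypothesis. -/
theorem not_cylEntropy_twoSlices_lt :
    ¬ cylEntropy (Set.range twoSlices) < ENNReal.ofReal (4 / Real.exp 1) := by
  intro hlt
  have h2 := two_le_cylEntropy_twoSlices
  have : (2 : ℝ≥0∞) < ENNReal.ofReal (4 / Real.exp 1) := lt_of_le_of_lt h2 hlt
  rw [show (2 : ℝ≥0∞) = ENNReal.ofReal 2 by simp] at this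
  have := (ENNReal.ofReal_lt_ofReal_iff (by positivity)).mp this
  linarith [four_div_exp_one_lt_two]


/-! ## The route is EXACTLY as hard as SPC4, modulo the calibration item

Uses the tree's `Manifold.IsSmoothEmbedding.comp_diffeomorph`
(`Literature.Topology.FourManifolds.CerfGammaFourProofs`) and `CylinderSlice.isSmoothEmbedding_sliceMap`. -/

/-- `SliceCalibration` is `λ_cyl(slice 0) = 1`, definitionally. -/
theorem sliceCalibration_iff : SliceCalibration ↔ cylEntropy (slice 0) = 1 := Iff.rfl

/-- `1 < 4/e` in `ℝ≥0∞`. -/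
theorem one_lt_ofReal_four_div_exp_one : (1 : ℝ≥0∞) < ENNReal.ofReal (4 / Real.exp 1) := by
  rw [ENNReal.one_lt_ofReal]
  linarith [four_div_exp_one_sub_one_pos]

open Literature.Geometry.Manifold.CylinderSlice in
/-- **Transport of the slice along a diffeomorphism**: if `λ_cyl(slice) < c` then every `M`
diffeomorphic to `S⁴` has a cross-section below `c` (`ι = sliceMap 0 ∘ d`, a smooth embedding by
the tree's `comp_diffeomorph`, with image the slice). -/
theorem hasCrossSectionBelow_of_diffeomorph {c : ℝ≥0∞} (hcal : cylEntropy (slice 0) < c)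
    (M : Type) [TopologicalSpace M] [ChartedSpace (EuclideanSpace ℝ (Fin 4)) M]
    [IsManifold (𝓡 4) ∞ M] (d : M ≃ₘ⟮𝓡 4, 𝓡 4⟯ 𝕊⁴) : HasCrossSectionBelow M c := by
  have hr : Set.range (sliceMap 0 ∘ d) = slice 0 := by
    rw [Set.range_comp, EquivLike.range_eq_univ d, Set.image_univ, range_sliceMap]
    rfl
  refine ⟨sliceMap 0 ∘ d, (isSmoothEmbedding_sliceMap 0).comp_diffeomorph d,
    fun x => sum_sq_sliceMap 0 (d x), ?_, ?_⟩
  · rw [hr]; exact separatesEnds_of_slice_subset (subset_refl _)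
  · rw [hr]; exact hcal

/-- **Non-vacuity of the crux modulo calibration**: `S⁴` itself has a cross-section below any
`c > λ_cyl(slice)`; in particular, given `SliceCalibration`, below `4/e` — so the hypotheses of
`CylinderRungTwo` are jointly satisfiable (by the slice, where the conclusion holds by `refl`). -/
theorem hasCrossSectionBelow_sphere_of_sliceCalibration (hcal : SliceCalibration) :
    HasCrossSectionBelow 𝕊⁴ (ENNReal.ofReal (4 / Real.exp 1)) := by
  refine hasCrossSectionBelow_of_diffeomorph ?_ 𝕊⁴ (Diffeomorph.refl _ _ _)
  rw [sliceCalibration_iff.mp hcal]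
  exact one_lt_ofReal_four_div_exp_one

/-- **`E ⇐ SPC4` machine-checked modulo calibration**: `SliceCalibration → SPC4 →
ThinCrossSectionExists`. -/
theorem thinCrossSectionExists_of_spc4 (hcal : SliceCalibration) (h : _root_.SmoothPoincare4) :
    ThinCrossSectionExists := by
  intro M _ _ _ _ _ e
  obtain ⟨d⟩ := h M ‹_› ‹_› e
  refine hasCrossSectionBelow_of_diffeomorph ?_ M d
  rw [sliceCalibration_iff.mp hcal]
  exact one_lt_ofReal_four_div_exp_one

/-- **The route's claim `X ⇔ SPC4`, as a theorem modulo the calibration item**: given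
`SliceCalibration`, `Target = E ∧ R` is EQUIVALENT to the summit.  So the line is exactly as hard
as SPC4 — no easier (any proof of `E ∧ R` proves SPC4: `closes`) and no harder (SPC4 gives both). -/
theorem target_iff_spc4_of_sliceCalibration (hcal : SliceCalibration) :
    Target ↔ _root_.SmoothPoincare4 :=
  ⟨fun h => Summit.SmoothPoincare4.SmoothPoincare4.Theses.CylinderEntropy.closes h.2 h.1,
    fun h => ⟨thinCrossSectionExists_of_spc4 hcal h, cylinderRungTwo_of_spc4 h⟩⟩

/-- Given calibration, every rung above `1`... is still SPC4-hard: `Rung c` for `1 < c` together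
with SPC4-for-`S⁴`-diffeomorphs is consistent, and `¬ Rung c` (for any `c > λ_cyl(slice)`) is
equivalent to the existence of an exotic sphere WITH a cross-section below `c`; the smallest
interesting threshold is therefore `c ↓ 1` (`SliceIsolation`), not `4/e`. -/
theorem not_rung_iff_exotic {c : ℝ≥0∞} :
    ¬ Rung c ↔ ∃ (M : Type) (_ : TopologicalSpace M) (_ : T2Space M) (_ : SecondCountableTopology M)
      (_ : ChartedSpace (EuclideanSpace ℝ (Fin 4)) M) (_ : IsManifold (𝓡 4) ∞ M),
      Nonempty (M ≃ₕ 𝕊⁴) ∧ HasCrossSectionBelow M c ∧ IsEmpty (M ≃ₘ⟮𝓡 4, 𝓡 4⟯ 𝕊⁴) :=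
  ⟨exotic_of_not_rung, not_rung_of_exotic⟩


/-! ## Monotonicity of the functional in the set -/

/-- The typed cylinder entropy is monotone in the set (the integrand is nonnegative). -/
theorem cylEntropy_mono {A B : Set E⁶} (h : A ⊆ B) : cylEntropy A ≤ cylEntropy B := by
  unfold cylEntropy
  gcongr

/-- Any admissible set containing a whole slice has typed entropy `≥ 1` (no separation
hypothesis needed; e.g. slice ⊔ anything). -/
theorem one_le_cylEntropy_of_slice_subset {A : Set E⁶} {c : ℝ} (hA : slice c ⊆ A) :
    1 ≤ cylEntropy A := by
  refine le_trans ?_ (cylEntropy_mono hA)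
  have hle := measure_le_cylEntropy (slice c) (fun z hz => hz.1)
    ((isClosed_eq (by fun_prop) continuous_const).inter
      (isClosed_eq ((EuclideanSpace.proj (5 : Fin 6)).continuous) continuous_const)).measurableSet
    ⟨|c|, fun z hz => by rw [hz.2]⟩
  rwa [hausdorffMeasure_slice, ENNReal.inv_mul_cancel hausdorffMeasure_sphere_four_ne_zero
    hausdorffMeasure_sphere_four_ne_top] at hle


/-! ## Targets — picked lines (2026-08-16): `killing-flux` (lead A), `proxy-models-below-bubble-sheet` (lead B)

Read at the cycle-1 resume: `Cruxes/CylinderRungTwo/PICKED.md`, `Lines/killing-flux.lean` (5 registered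
stubs), drefute notes (`DrefuteKillingFluxStubs.md`, landed `Negative/KillingFluxFluxIdentityLoadBearing.lean`
p75817), `HarnackNumericsK3.md` (ideator 3: both Harnack eigenvalues of the `S⁴` kernel `≥ min(1/2,1/2τ) - o(1)`,
normalisation `= 1` — corroborates my kernel read-back independently).  Verdicts of the standing disprover
on the killing-flux stubs (no payload `targets` were handed over; cheap attacks only):

* `stub_finiteTimeHalf` — SPC4-sandwiched exactly like the crux (its conclusion holds for `M ≃ₘ S⁴` via the
  transported static slice flow modulo `SliceCalibration` and interface-transport lemmas, and fails for a
  thin exotic cross-section): NOT cheaply refutable; it is where `exotic_of_not_rung` lives now.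
* `stub_fluxIdentity` (repaired: `ConnectedSpace M`, continuous unit normal field, absolute value) — a true
  classical identity (Jordan–Brouwer in `N ≅ S⁵ ∖ 2 pts` + divergence theorem for the parallel field `e₅`;
  both sides scale by the same universal `μH[4]`-vs-Riemannian constant, so Mathlib's un-normalised `μH`
  is consistent); `Measure.comap ι μH[4]` is the honest pull-back for a closed embedding (measurable
  embedding), so no junk; drefute showed `Continuous ν` and `|·|` are load-bearing.  Nothing to kill.
* `stub_relaxation` — the threshold `< 2` is TIGHT in the following sense (`two_le_cylEntropy_twoSlices`):
  the static two-slice configuration is an immortal smooth flow of a separating (disconnected) cross-section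
  with `λ_cyl ≥ 2`; so `ConnectedSpace M` or the strict `< 2` is what excludes it (a Lean kill of
  "Relaxation with `≤ 2` and without `ConnectedSpace`" would need `IsCylinderMCF` on `S⁴ ⊔ S⁴` and the
  calibration `λ_cyl(two slices) = 2`, neither in reach).  With `ConnectedSpace M` kept, no static
  counterexample exists (only slices are closed minimal hypersurfaces of `N`; compact translators are
  excluded by the Killing flux `∫_M H⟨e₅,ν⟩ = 0`).  No slab / bounded-height hypothesis is assumed: drift to
  `±∞` is only excluded inside the proof (linearised flow conserves mean height) — flag for the lead, not a
  kill.
* `stub_epsilonGraphical`, `stub_graphicalIsSphere` — honest `L` / `M` statements; the static version of the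
  former is false (acknowledged in its docstring: one unit of flow is a hypothesis); the latter is true
  (injective local diffeomorphism of a compact connected `M` onto the connected `S⁴`).

So the line is sound as typed; its SPC4-hard content is confined to `stub_finiteTimeHalf`, as the sandwich
predicts for every line. -/

open Literature.Geometry.Manifold.CylinderSlice in
/-- Target remark made checkable: the two-slice configuration is a separating smoothly embedded
`S⁴ ⊔ S⁴` in `N` of typed entropy `≥ 2` — the object against which `stub_relaxation`'s `ConnectedSpace M`
/ strict `< 2` are load-bearing. -/
theorem relaxation_threshold_witness :
    Manifold.IsSmoothEmbedding (𝓡 4) (𝓡 6) ∞ twoSlices ∧ InCylinder twoSlices ∧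
      SeparatesEnds (Set.range twoSlices) ∧ 2 ≤ cylEntropy (Set.range twoSlices) := by
  refine ⟨isSmoothEmbedding_twoSlices, sum_sq_twoSlices, ?_, two_le_cylEntropy_twoSlices⟩
  apply separatesEnds_of_slice_subset (h := 0)
  rw [range_twoSlices]
  exact Set.subset_union_left

end

end Summit.SmoothPoincare4.SmoothPoincare4.Cruxes.CylinderRungTwo.Disproof
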